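import Literature.Analysis.FluidPDE.HomogeneousEulerBernoulliRigidity
import Literature.Analysis.FluidPDE.HomogeneousEulerAxisymmetric
import Literature.Analysis.FluidPDE.SwirlTransportProofs
import Mathlib.Analysis.SpecialFunctions.Pow.Continuity
import Mathlib.Analysis.SpecialFunctions.Complex.Arg
import HarnessLib

/-!
# No axisymmetric homogeneous stationary Euler flows in the window `1 < α < 2` (Shvydkoy 2018, Prop. 5.1, window part — proved)

R. Shvydkoy, *Homogeneous solutions to the 3D Euler system*, Trans. Amer. Math. Soc. 370 (2018)
2517–2535 = arXiv:1510.03378 [`Shvydkoy2018`], §5 "Axisymmetric solutions" (arXiv p. 11):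

> **Proposition 5.1.** There are no `C²` axisymmetric solutions in the range `0 < α < 2`.

(Here a solution is a stationary Euler pair `V·∇V + ∇P = 0`, `div V = 0` on `ℝ³ ∖ {0}`,
homogeneous of degrees `-α` and `-2α` — the tree's `IsHomogeneousSteadyEuler α V P`,
`HomogeneousEuler.lean` — which is axisymmetric with or without swirl.)  The tree holds the
proposition as the NAMED FACT `shvydkoy2018_prop51_noAxisymmetric` (`HomogeneousEulerAxisymmetric.lean`).
This file PROVES it in the sub-range `1 < α < 2` — the one containing the Chae–Shvydkoy window
`α = 1 + ρ ∈ (1, 3/2]` of crux `E` of `NavierStokesRegularity/EulerZoomLiouville`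
(`stub_selfSimilarExtremal`, homogeneous-tail sub-case: `SelfSimilarEulerHomogeneousTail.lean`) —
and for the tree's `C¹` class (the printed `C²` is not needed in this range):

* `IsHomogeneousSteadyEuler.eq_zero_of_isAxisymmetric` — `1 < α < 2`, `IsAxisymmetric V`,
  `IsAxisymmetricScalar P` ⇒ `V ≡ 0` off the origin;
* `shvydkoy2018_prop51_noAxisymmetric_of_one_lt` — verbatim the body of the named fact with
  `0 < α` replaced by `1 < α` (so the fact's `C²` hypotheses are carried, unused);
* `shvydkoy2018_prop51_noAxisymmetric_of_one_lt.eq_zero` — `V ≡ 0 ∧ P ≡ 0`.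

For the COMPLEMENTARY range `0 < α < 1` (taken by another seat: zonal Bernoulli-free rigidity +
a zonal spectral gap, i.e. the axisymmetric cases of Props. 3.2/3.1), this file also exposes, for
ALL `α`:

* `IsHomogeneousSteadyEuler.bernoulliFn_eq_zero_of_isAxisymmetric` — `0 < α < 2`, `α ≠ 1`,
  axisymmetric ⇒ `‖V x‖² + 2 P x = 0` off the origin ("`H = 0` on the entire sphere", bulk form);
* the meridian system for the functions `a = ⟪V∘s, e⟫`, `b = (V∘s)₁`, `f = ⟪V∘s, s⟫`, `p = P∘s`,
  `H = ‖V∘s‖² + 2P∘s` of the polar angle (characterised by hypotheses, instantiate with `rfl`):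
  `meridian_bernoulli_eq` (`H = a² + b² + f² + 2p`), `meridian_hasDerivAt` (all five are `C¹`,
  with their derivatives), `meridian_div` ((A1)·`sin φ`), `meridian_momentum` ((A2)–(A4)·`sin φ`),
  `meridian_bernoulli_transport` ((AH)·`sin φ`) — valid at EVERY `φ ∈ ℝ`, poles included —,
  `meridian_poles` (`a(0) = a(π) = b(0) = b(π) = 0`, `f'(0) = f'(π) = 0`) and `meridian_contDiff`
  (`V, P ∈ Cⁿ` off the origin ⇒ `a, b, f, p, H ∈ Cⁿ(ℝ)`); and the passage meridian → space:
  `meridian_velocity_eq` (`V∘s = a e + b E₁ + f s`, `‖V∘s‖² = a²+b²+f²`),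
  `exists_eq_norm_smul_rotZ_meridian` (spherical coordinates), `eq_zero_of_meridian_velocity_eq_zero`
  (axisymmetric + homogeneous, `V = 0` on the closed meridian ⇒ `V ≡ 0` off the origin).

## The printed proof and its transcription

Printed proof (arXiv p. 11; equation LABELS below are ours — (A1)–(A4) for the four equations of
the axisymmetric system displayed after "The system … in our case reduces to", (AH) for the
transport relation, (CL1)/(CL2) for the two conservation laws, (T)/(TS) for the tangential system
and its explicit solutions of §4, Prop. 4.1; the published equation numbers are not asserted).  In
spherical variables `v = a e_φ + b e_θ`, `f`, `p` depending on the polar angle `φ ∈ (0, π)` only,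
the system is (A1) `(2-α)f + a' + a cot φ = 0`, (A2) `a f' = a² + b² + αf² + 2αp`,
(A3) `(1-α)fa + aa' - b² cot φ = -p'`, (A4) `(1-α)fb + ab' + ab cot φ = 0`; the Bernoulli
transport (8) `v∇H = 2αfH` reads (AH) `a H' = 2α f H`, and two conservation laws follow: (CL1)
`|b|^{2-α}|a|^{α-1} sin φ = A` and (CL2) `|H|^{2-α}|a sin φ|^{2α} = B`.  "If `aH ≠ 0` on some
interval `I`, then we immediately obtain from [(CL2)] that `I = (0,π)`, and since `sin φ`
vanishes, `H` becomes unbounded, which is a contradiction. Then `aH = 0` everywhere. Suppose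
`H ≠ 0` on some interval `I`. Then `a = 0`, and from [(A1)], `f = 0`. The entire system reduces to
[(T): `b² + 2αp = 0`, `b² cot φ = p'`] with explicit solutions [(TS): `b = A/sin^α φ`,
`p = -A/(2α sin^{2α} φ)`]. These imply that `I = (0,π)` since `H` stays bounded away from zero.
Hence `H` blows up, which is a contradiction. We have proved that `H = 0` on the entire sphere. By
Proposition 3.2 such solutions are irrotational and `α` is an integer, which excludes solutions in
the given range."

Transcription (bulk variables, no definitions).  The meridian `θ = 0` of the unit sphere is
parametrised by `s φ = (sin φ, 0, cos φ) = sin φ · E₀ + cos φ · E₂` with frame `e φ = s'(φ)`,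
`E₁`, `s φ`; then `a = ⟪V∘s, e⟫`, `b = (V∘s)₁`, `f = ⟪V∘s, s⟫`, `p = P∘s`, `H = ‖V∘s‖² + 2 P∘s`
(taken as variables characterised by hypotheses `hs`, `he`, `ha`, `hH`).  From `div V = 0`,
Euler's relation `DV(x)x = -αV(x)`, infinitesimal axisymmetry `DV(x)(Jx) = J V(x)`
(`IsAxisymmetric.fderiv_rotGen`, with `J (s φ) = sin φ · E₁`), the momentum equation and the
transport of the Bernoulli function we derive the bulk forms of (A1) (`div_merid`), (AH)
(`bernoulli_transport_merid`) and, where `a = 0`, of (A2)–(A3) (`momentum_merid_of_a_eq_zero`).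
The two interval arguments are run with the continuous conserved quantities
`K = (H²)^{(2-α)/2}((a sin φ)²)^α` and `K₂ = H²(sin² φ)^{2α}`: each is locally constant on the
open set where it is positive (its logarithm has zero derivative there, by (A1)+(AH), resp. by
(T)–(TS) in the form `b² + 2αp = 0`, `p' sin φ = b² cos φ`, `H = 2(1-α)p`), the set where it
equals its value at one point is therefore clopen in the connected `(0, π)` and contains `0` in its
closure — where the quantity vanishes because `sin 0 = 0` (`apply_zero_eq_of_locally_const`).  This
gives `aH ≡ 0` (`a_eq_zero_or_H_eq_zero`) and then `H ≡ 0` on `(0, π)` (`H_eq_zero_of_mem_Ioo`), on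
`[0, π]` by continuity, and on all of `ℝ³ ∖ {0}` by axisymmetry and homogeneity.  The last sentence
of the printed proof is replaced, in the window `1 < α < 2`, by the "straightforward case" of
Prop. 3.2 proved in `HomogeneousEulerBernoulliRigidity.lean`
(`IsHomogeneousSteadyEuler.eq_zero_of_bernoulli_eq_zero`: `(2-α)∫f² = (1-α)∫|v|²`), which needs
neither irrotationality nor the Laplace–Beltrami spectrum.

Scope / honesty.  NOT proved: the range `0 < α ≤ 1` of Prop. 5.1 (it needs Prop. 3.2 for `α < 1`
and Prop. 3.1, `α ∈ ℤ`; at `α = 1` the tree has `shvydkoy_homogeneousSteadyEuler_alpha_one_holds`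
for all `C¹` solutions), so the named fact `shvydkoy2018_prop51_noAxisymmetric` is NOT discharged
here; nothing about non-axisymmetric solutions; no statement about Navier–Stokes.  `C²` of the
printed statement is weakened to `C¹` (only first derivatives of `V`, `P` enter).  The axis of
symmetry is the tree's `x₂`-axis (`rotZ`); `P` axisymmetric is assumed as in the fact (it follows
from `V` axisymmetric, cf. `IsSelfSimilarEulerProfile.isAxisymmetricScalar_pressure`, not redone).

## References

* R. Shvydkoy, *Homogeneous solutions to the 3D Euler system*, Trans. Amer. Math. Soc. 370
  (2018) 2517–2535, doi:10.1090/tran/7022 = arXiv:1510.03378; §5 Prop. 5.1 and its proof,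
  the axisymmetric system, the relation `aH' = 2αfH` and the two conservation laws (arXiv
  p. 11); §4 Prop. 4.1 (tangential solutions); §3 Prop. 3.2; §2 eq. (8). [`Shvydkoy2018`]
* K. Abe, *Existence of homogeneous Euler flows of degree `-α ∉ [-2,0]`*, Arch. Ration. Mech.
  Anal. 248 (2024) = arXiv:2305.05987, Thm 1.5 (i)–(ii) (restates Prop. 5.1).
* D. Chae, R. Shvydkoy, ARMA 209 (2013) = arXiv:1201.6009, §4.1 (homogeneous near infinity).
-/

noncomputable section

open Set Filter Module
open scoped InnerProductSpace RealInnerProductSpace Topology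

namespace Literature.Analysis.FluidPDE

namespace IsHomogeneousSteadyEuler

/-! ### Coordinates on `ℝ³` and the meridian frame (private plumbing) -/

/-- `⟪v, w⟫ = v₀w₀ + v₁w₁ + v₂w₂` on `ℝ³`. [folklore] -/
private theorem inner_fin3 (v w : EuclideanSpace ℝ (Fin 3)) :
    ⟪v, w⟫ = v 0 * w 0 + v 1 * w 1 + v 2 * w 2 := by
  simp only [PiLp.inner_apply, Fin.sum_univ_three, RCLike.inner_apply, conj_trivial]
  ring

/-- `‖w‖² = w₀² + w₁² + w₂²` on `ℝ³`. [folklore] -/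
private theorem norm_sq_fin3 (w : EuclideanSpace ℝ (Fin 3)) :
    ‖w‖ ^ 2 = w 0 ^ 2 + w 1 ^ 2 + w 2 ^ 2 := by
  rw [← real_inner_self_eq_norm_sq, inner_fin3]; ring

section Meridian

/-! The meridian `θ = 0` of the unit sphere, parametrised by the polar angle:
`s φ = (sin φ, 0, cos φ)`, with tangent frame `e φ = (cos φ, 0, -sin φ) = s'(φ)` (along the
meridian), `E₁ = (0, 1, 0)` (azimuthal, `J (s φ) = sin φ · E₁` for the rotation generator `J`)
and normal `s φ`.  Both are taken as variables characterised by `hs`, `he` (no definitions). -/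

variable {s e : ℝ → EuclideanSpace ℝ (Fin 3)}

/-- Components of the meridian point `s φ = (sin φ, 0, cos φ)`. [folklore] -/
private theorem merid_apply
    (hs : ∀ φ, s φ = Real.sin φ • EuclideanSpace.single 0 (1 : ℝ) +
      Real.cos φ • EuclideanSpace.single 2 (1 : ℝ)) (φ : ℝ) :
    s φ 0 = Real.sin φ ∧ s φ 1 = 0 ∧ s φ 2 = Real.cos φ := by
  refine ⟨?_, ?_, ?_⟩ <;> simp [hs]

/-- Components of the meridian tangent `e φ = (cos φ, 0, -sin φ)`. [folklore] -/
private theorem frame_apply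
    (he : ∀ φ, e φ = Real.cos φ • EuclideanSpace.single 0 (1 : ℝ) -
      Real.sin φ • EuclideanSpace.single 2 (1 : ℝ)) (φ : ℝ) :
    e φ 0 = Real.cos φ ∧ e φ 1 = 0 ∧ e φ 2 = -Real.sin φ := by
  refine ⟨?_, ?_, ?_⟩ <;> simp [he]

/-- `⟪w, s φ⟫ = sin φ · w₀ + cos φ · w₂`. [folklore] -/
private theorem inner_merid
    (hs : ∀ φ, s φ = Real.sin φ • EuclideanSpace.single 0 (1 : ℝ) +
      Real.cos φ • EuclideanSpace.single 2 (1 : ℝ)) (w : EuclideanSpace ℝ (Fin 3)) (φ : ℝ) :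
    ⟪w, s φ⟫ = Real.sin φ * w 0 + Real.cos φ * w 2 := by
  obtain ⟨h0, h1, h2⟩ := merid_apply hs φ
  rw [inner_fin3, h0, h1, h2]; ring

/-- `⟪w, e φ⟫ = cos φ · w₀ - sin φ · w₂`. [folklore] -/
private theorem inner_frame
    (he : ∀ φ, e φ = Real.cos φ • EuclideanSpace.single 0 (1 : ℝ) -
      Real.sin φ • EuclideanSpace.single 2 (1 : ℝ)) (w : EuclideanSpace ℝ (Fin 3)) (φ : ℝ) :
    ⟪w, e φ⟫ = Real.cos φ * w 0 - Real.sin φ * w 2 := by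
  obtain ⟨h0, h1, h2⟩ := frame_apply he φ
  rw [inner_fin3, h0, h1, h2]; ring

/-- `⟪w, E₁⟫ = w₁`. [folklore] -/
private theorem inner_single_one (w : EuclideanSpace ℝ (Fin 3)) :
    ⟪w, EuclideanSpace.single 1 (1 : ℝ)⟫ = w 1 := by
  rw [inner_fin3]; simp

/-- The meridian point is a unit vector: `‖s φ‖² = 1`. [folklore] -/
private theorem norm_sq_merid
    (hs : ∀ φ, s φ = Real.sin φ • EuclideanSpace.single 0 (1 : ℝ) +
      Real.cos φ • EuclideanSpace.single 2 (1 : ℝ)) (φ : ℝ) : ‖s φ‖ ^ 2 = 1 := by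
  obtain ⟨h0, h1, h2⟩ := merid_apply hs φ
  rw [norm_sq_fin3, h0, h1, h2]
  nlinarith [Real.sin_sq_add_cos_sq φ]

/-- The meridian point is non-zero. [folklore] -/
private theorem merid_ne_zero
    (hs : ∀ φ, s φ = Real.sin φ • EuclideanSpace.single 0 (1 : ℝ) +
      Real.cos φ • EuclideanSpace.single 2 (1 : ℝ)) (φ : ℝ) : s φ ≠ 0 := by
  intro h0
  have h1 := norm_sq_merid hs φ
  rw [h0, norm_zero] at h1
  norm_num at h1

/-- Frame inner products: `⟪s, s⟫ = 1`, `⟪e, e⟫ = 1`, `⟪s, e⟫ = 0`, `⟪e, s⟫ = 0`,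
`⟪E₁, s⟫ = 0`, `⟪E₁, e⟫ = 0`. [folklore] -/
private theorem frame_inner
    (hs : ∀ φ, s φ = Real.sin φ • EuclideanSpace.single 0 (1 : ℝ) +
      Real.cos φ • EuclideanSpace.single 2 (1 : ℝ))
    (he : ∀ φ, e φ = Real.cos φ • EuclideanSpace.single 0 (1 : ℝ) -
      Real.sin φ • EuclideanSpace.single 2 (1 : ℝ)) (φ : ℝ) :
    ⟪s φ, s φ⟫ = 1 ∧ ⟪e φ, e φ⟫ = 1 ∧ ⟪s φ, e φ⟫ = 0 ∧ ⟪e φ, s φ⟫ = 0 ∧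
      ⟪EuclideanSpace.single 1 (1 : ℝ), s φ⟫ = 0 ∧ ⟪EuclideanSpace.single 1 (1 : ℝ), e φ⟫ = 0 := by
  obtain ⟨h0, h1, h2⟩ := merid_apply hs φ
  obtain ⟨k0, k1, k2⟩ := frame_apply he φ
  refine ⟨?_, ?_, ?_, ?_, ?_, ?_⟩
  · rw [inner_merid hs, h0, h2]; nlinarith [Real.sin_sq_add_cos_sq φ]
  · rw [inner_frame he, k0, k2]; nlinarith [Real.sin_sq_add_cos_sq φ]
  · rw [inner_frame he, h0, h2]; ring
  · rw [inner_merid hs, k0, k2]; ring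
  · rw [inner_merid hs]; simp
  · rw [inner_frame he]; simp

/-- The rotation generator on the meridian: `J (s φ) = sin φ · E₁`. [folklore] -/
private theorem rotGen_merid
    (hs : ∀ φ, s φ = Real.sin φ • EuclideanSpace.single 0 (1 : ℝ) +
      Real.cos φ • EuclideanSpace.single 2 (1 : ℝ)) (φ : ℝ) :
    rotGen (s φ) = Real.sin φ • EuclideanSpace.single 1 (1 : ℝ) := by
  obtain ⟨h0, h1, h2⟩ := merid_apply hs φ
  rw [rotGen_eq_sub_single, h0, h1, zero_smul, sub_zero]

/-- The standard vectors `E₀`, `E₂` in the meridian frame: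
`E₀ = sin φ · s + cos φ · e`, `E₂ = cos φ · s - sin φ · e`. [folklore] -/
private theorem single_zero_two_eq
    (hs : ∀ φ, s φ = Real.sin φ • EuclideanSpace.single 0 (1 : ℝ) +
      Real.cos φ • EuclideanSpace.single 2 (1 : ℝ))
    (he : ∀ φ, e φ = Real.cos φ • EuclideanSpace.single 0 (1 : ℝ) -
      Real.sin φ • EuclideanSpace.single 2 (1 : ℝ)) (φ : ℝ) :
    EuclideanSpace.single 0 (1 : ℝ) = Real.sin φ • s φ + Real.cos φ • e φ ∧
      EuclideanSpace.single 2 (1 : ℝ) = Real.cos φ • s φ - Real.sin φ • e φ := by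
  obtain ⟨h0, h1, h2⟩ := merid_apply hs φ
  obtain ⟨k0, k1, k2⟩ := frame_apply he φ
  have hsc := Real.sin_sq_add_cos_sq φ
  constructor
  · ext i
    fin_cases i
    · simp [h0, k0]; nlinarith [hsc]
    · simp [h1, k1]
    · simp [h2, k2]; ring
  · ext i
    fin_cases i
    · simp [h0, k0]; ring
    · simp [h1, k1]
    · simp [h2, k2]; nlinarith [hsc]

/-- `J E₁ = -E₀ = -(sin φ · s + cos φ · e)`. [folklore] -/
private theorem rotGen_single_one_eq
    (hs : ∀ φ, s φ = Real.sin φ • EuclideanSpace.single 0 (1 : ℝ) +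
      Real.cos φ • EuclideanSpace.single 2 (1 : ℝ))
    (he : ∀ φ, e φ = Real.cos φ • EuclideanSpace.single 0 (1 : ℝ) -
      Real.sin φ • EuclideanSpace.single 2 (1 : ℝ)) (φ : ℝ) :
    rotGen (EuclideanSpace.single 1 (1 : ℝ)) = -(Real.sin φ • s φ + Real.cos φ • e φ) := by
  rw [rotGen_single_one, (single_zero_two_eq hs he φ).1]

/-- Decomposition of a vector in the meridian frame:
`w = ⟪w, e⟫ e + w₁ E₁ + ⟪w, s⟫ s`. [folklore] -/
private theorem frame_decomp
    (hs : ∀ φ, s φ = Real.sin φ • EuclideanSpace.single 0 (1 : ℝ) +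
      Real.cos φ • EuclideanSpace.single 2 (1 : ℝ))
    (he : ∀ φ, e φ = Real.cos φ • EuclideanSpace.single 0 (1 : ℝ) -
      Real.sin φ • EuclideanSpace.single 2 (1 : ℝ)) (w : EuclideanSpace ℝ (Fin 3)) (φ : ℝ) :
    w = ⟪w, e φ⟫ • e φ + w 1 • EuclideanSpace.single 1 (1 : ℝ) + ⟪w, s φ⟫ • s φ := by
  obtain ⟨h0, h1, h2⟩ := merid_apply hs φ
  obtain ⟨k0, k1, k2⟩ := frame_apply he φ
  have hsc := Real.sin_sq_add_cos_sq φ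
  rw [inner_merid hs, inner_frame he]
  ext i
  fin_cases i
  · simp [h0, k0]; linear_combination (-(w 0)) * hsc
  · simp [h1, k1]
  · simp [h2, k2]; linear_combination (-(w 2)) * hsc

/-- Pythagoras in the meridian frame: `‖w‖² = ⟪w, e⟫² + w₁² + ⟪w, s⟫²`. [folklore] -/
private theorem norm_sq_frame
    (hs : ∀ φ, s φ = Real.sin φ • EuclideanSpace.single 0 (1 : ℝ) +
      Real.cos φ • EuclideanSpace.single 2 (1 : ℝ))
    (he : ∀ φ, e φ = Real.cos φ • EuclideanSpace.single 0 (1 : ℝ) -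
      Real.sin φ • EuclideanSpace.single 2 (1 : ℝ)) (w : EuclideanSpace ℝ (Fin 3)) (φ : ℝ) :
    ‖w‖ ^ 2 = ⟪w, e φ⟫ ^ 2 + w 1 ^ 2 + ⟪w, s φ⟫ ^ 2 := by
  rw [norm_sq_fin3, inner_merid hs, inner_frame he]
  nlinarith [Real.sin_sq_add_cos_sq φ]

/-- The meridian point has velocity `e`: `s' = e`. [folklore] -/
private theorem hasDerivAt_merid
    (hs : ∀ φ, s φ = Real.sin φ • EuclideanSpace.single 0 (1 : ℝ) +
      Real.cos φ • EuclideanSpace.single 2 (1 : ℝ))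
    (he : ∀ φ, e φ = Real.cos φ • EuclideanSpace.single 0 (1 : ℝ) -
      Real.sin φ • EuclideanSpace.single 2 (1 : ℝ)) (φ : ℝ) : HasDerivAt s (e φ) φ := by
  have h1 : s = (fun φ => Real.sin φ • EuclideanSpace.single 0 (1 : ℝ)) +
      fun φ => Real.cos φ • EuclideanSpace.single 2 (1 : ℝ) := by
    funext ψ; simp only [Pi.add_apply, hs]
  have h2 := ((Real.hasDerivAt_sin φ).smul_const (EuclideanSpace.single (0 : Fin 3) (1 : ℝ))).add
    ((Real.hasDerivAt_cos φ).smul_const (EuclideanSpace.single (2 : Fin 3) (1 : ℝ)))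
  have h3 : Real.cos φ • EuclideanSpace.single (0 : Fin 3) (1 : ℝ) +
      -Real.sin φ • EuclideanSpace.single (2 : Fin 3) (1 : ℝ) = e φ := by
    rw [he]; ext i; fin_cases i <;> simp
  rw [h1]
  exact h2.congr_deriv h3

/-- The meridian tangent has velocity `-s`: `e' = -s`. [folklore] -/
private theorem hasDerivAt_frame
    (hs : ∀ φ, s φ = Real.sin φ • EuclideanSpace.single 0 (1 : ℝ) +
      Real.cos φ • EuclideanSpace.single 2 (1 : ℝ))
    (he : ∀ φ, e φ = Real.cos φ • EuclideanSpace.single 0 (1 : ℝ) -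
      Real.sin φ • EuclideanSpace.single 2 (1 : ℝ)) (φ : ℝ) : HasDerivAt e (-s φ) φ := by
  have h1 : e = (fun φ => Real.cos φ • EuclideanSpace.single 0 (1 : ℝ)) -
      fun φ => Real.sin φ • EuclideanSpace.single 2 (1 : ℝ) := by
    funext ψ; simp only [Pi.sub_apply, he]
  have h2 := ((Real.hasDerivAt_cos φ).smul_const (EuclideanSpace.single (0 : Fin 3) (1 : ℝ))).sub
    ((Real.hasDerivAt_sin φ).smul_const (EuclideanSpace.single (2 : Fin 3) (1 : ℝ)))
  have h3 : -Real.sin φ • EuclideanSpace.single (0 : Fin 3) (1 : ℝ) -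
      Real.cos φ • EuclideanSpace.single (2 : Fin 3) (1 : ℝ) = -s φ := by
    rw [hs]; ext i; fin_cases i <;> simp
  rw [h1]
  exact h2.congr_deriv h3

/-- The meridian point is a smooth function of the angle. [folklore] -/
private theorem contDiff_merid
    (hs : ∀ φ, s φ = Real.sin φ • EuclideanSpace.single 0 (1 : ℝ) +
      Real.cos φ • EuclideanSpace.single 2 (1 : ℝ)) : ContDiff ℝ 1 s := by
  have h1 : s = fun φ => Real.sin φ • EuclideanSpace.single 0 (1 : ℝ) +
      Real.cos φ • EuclideanSpace.single 2 (1 : ℝ) := funext hs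
  rw [h1]
  exact (Real.contDiff_sin.smul contDiff_const).add (Real.contDiff_cos.smul contDiff_const)

/-- The meridian tangent is a smooth function of the angle. [folklore] -/
private theorem contDiff_frame
    (he : ∀ φ, e φ = Real.cos φ • EuclideanSpace.single 0 (1 : ℝ) -
      Real.sin φ • EuclideanSpace.single 2 (1 : ℝ)) : ContDiff ℝ 1 e := by
  have h1 : e = fun φ => Real.cos φ • EuclideanSpace.single 0 (1 : ℝ) -
      Real.sin φ • EuclideanSpace.single 2 (1 : ℝ) := funext he
  rw [h1]
  exact (Real.contDiff_cos.smul contDiff_const).sub (Real.contDiff_sin.smul contDiff_const)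

end Meridian

/-! ### The Bernoulli function is an axisymmetric scalar -/

/-- For axisymmetric `V` and `P`, the Bernoulli function `‖V‖² + 2P` is an axisymmetric scalar
(`‖R_θ v‖ = ‖v‖`). [folklore] -/
private theorem isAxisymmetricScalar_bernoulliFn
    {V : EuclideanSpace ℝ (Fin 3) → EuclideanSpace ℝ (Fin 3)} {P : EuclideanSpace ℝ (Fin 3) → ℝ}
    (hax : IsAxisymmetric V) (haxP : IsAxisymmetricScalar P) :
    IsAxisymmetricScalar (fun y => ‖V y‖ ^ 2 + 2 * P y) := by
  intro θ x
  simp only [hax θ x, haxP θ x, norm_rotZ]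

/-! ### The reduced system on the meridian (Shvydkoy's axisymmetric system (A1)–(A4) and (AH), bulk form) -/

section Pointwise

variable {α : ℝ} {V : EuclideanSpace ℝ (Fin 3) → EuclideanSpace ℝ (Fin 3)}
  {P : EuclideanSpace ℝ (Fin 3) → ℝ} {s e : ℝ → EuclideanSpace ℝ (Fin 3)}

/-- The momentum equation in inner form, `⟪DV(x) V x, w⟫ = -DP(x) w`. [cite: Shvydkoy2018, (1) p. 2518] -/
private theorem inner_fderiv_velocity_velocity (h : IsHomogeneousSteadyEuler α V P)
    {x : EuclideanSpace ℝ (Fin 3)} (hx : x ≠ 0) (w : EuclideanSpace ℝ (Fin 3)) :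
    ⟪fderiv ℝ V x (V x), w⟫ = -fderiv ℝ P x w := by
  have hm := h.momentum hx
  rw [convect_apply, add_eq_zero_iff_eq_neg] at hm
  rw [hm, inner_neg_left, Shvydkoy2018.inner_gradient_left]

/-- `V·∇(‖V‖² + 2P) = 0` (the Bernoulli function is transported, Shvydkoy (8)). [cite: Shvydkoy2018, (8) p. 2521] -/
private theorem fderiv_bernoulliFn_velocity (h : IsHomogeneousSteadyEuler α V P)
    {x : EuclideanSpace ℝ (Fin 3)} (hx : x ≠ 0) :
    fderiv ℝ (fun y => ‖V y‖ ^ 2 + 2 * P y) x (V x) = 0 := by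
  rw [(Shvydkoy2018.hasFDerivAt_bernoulliFn (h.differentiableAt_velocity hx)
    (h.differentiableAt_pressure hx)).fderiv]
  simp only [add_apply, smul_apply, ContinuousLinearMap.comp_apply, innerSL_apply_apply,
    nsmul_eq_mul, smul_eq_mul]
  rw [real_inner_comm, inner_fderiv_velocity_velocity h hx]
  ring

/-- The azimuthal derivative of the velocity on the meridian:
`sin φ · DV(s φ) E₁ = J (V (s φ))` (infinitesimal axisymmetry `DV(x) Jx = J V(x)` with
`J (s φ) = sin φ · E₁`). [folklore] -/
private theorem sin_smul_fderiv_velocity_single_one (h : IsHomogeneousSteadyEuler α V P)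
    (hax : IsAxisymmetric V)
    (hs : ∀ φ, s φ = Real.sin φ • EuclideanSpace.single 0 (1 : ℝ) +
      Real.cos φ • EuclideanSpace.single 2 (1 : ℝ)) (φ : ℝ) :
    Real.sin φ • fderiv ℝ V (s φ) (EuclideanSpace.single 1 (1 : ℝ)) = rotGen (V (s φ)) := by
  have hJ := hax.fderiv_rotGen (h.differentiableAt_velocity (merid_ne_zero hs φ))
  rwa [rotGen_merid hs φ, map_smul] at hJ

/-- The azimuthal derivative of an axisymmetric scalar on the meridian vanishes:
`sin φ · Dq(s φ) E₁ = 0`. [folklore] -/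
private theorem sin_mul_fderiv_scalar_single_one {q : EuclideanSpace ℝ (Fin 3) → ℝ}
    (hq : IsAxisymmetricScalar q)
    (hs : ∀ φ, s φ = Real.sin φ • EuclideanSpace.single 0 (1 : ℝ) +
      Real.cos φ • EuclideanSpace.single 2 (1 : ℝ)) {φ : ℝ}
    (hd : DifferentiableAt ℝ q (s φ)) :
    Real.sin φ * fderiv ℝ q (s φ) (EuclideanSpace.single 1 (1 : ℝ)) = 0 := by
  have hJ := hq.fderiv_rotGen hd
  rwa [rotGen_merid hs φ, map_smul, smul_eq_mul] at hJ

/-- `⟪J v, e φ⟫ = -v₁ cos φ` and `⟪J v, s φ⟫ = -v₁ sin φ`. [folklore] -/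
private theorem inner_rotGen_frame
    (hs : ∀ φ, s φ = Real.sin φ • EuclideanSpace.single 0 (1 : ℝ) +
      Real.cos φ • EuclideanSpace.single 2 (1 : ℝ))
    (he : ∀ φ, e φ = Real.cos φ • EuclideanSpace.single 0 (1 : ℝ) -
      Real.sin φ • EuclideanSpace.single 2 (1 : ℝ)) (v : EuclideanSpace ℝ (Fin 3)) (φ : ℝ) :
    ⟪rotGen v, e φ⟫ = -(v 1 * Real.cos φ) ∧ ⟪rotGen v, s φ⟫ = -(v 1 * Real.sin φ) := by
  obtain ⟨h0, h1, -⟩ := merid_apply hs φ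
  obtain ⟨k0, k1, -⟩ := frame_apply he φ
  rw [inner_rotGen_left, inner_rotGen_left, h0, h1, k0, k1]
  constructor <;> ring

/-- **Shvydkoy (AH), bulk form: `a H' = 2α f H` on the meridian.** With `a = ⟪V, e⟫`,
`f = ⟪V, s⟫`, `H = ‖V‖² + 2P` at `s φ` and `H' = D(‖V‖²+2P)(s φ) e φ` (`sin φ ≠ 0`):
`a · H' = 2α · f · H` (from `V·∇B = 0`, `∂_θ B = 0`, `x·∇B = -2αB`). [cite: Shvydkoy2018, §5 proof of Prop. 5.1 (aH' = 2αfH)] -/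
private theorem bernoulli_transport_merid (h : IsHomogeneousSteadyEuler α V P)
    (hax : IsAxisymmetric V) (haxP : IsAxisymmetricScalar P)
    (hs : ∀ φ, s φ = Real.sin φ • EuclideanSpace.single 0 (1 : ℝ) +
      Real.cos φ • EuclideanSpace.single 2 (1 : ℝ))
    (he : ∀ φ, e φ = Real.cos φ • EuclideanSpace.single 0 (1 : ℝ) -
      Real.sin φ • EuclideanSpace.single 2 (1 : ℝ)) {φ : ℝ} (hφ : Real.sin φ ≠ 0) :
    ⟪V (s φ), e φ⟫ * fderiv ℝ (fun y => ‖V y‖ ^ 2 + 2 * P y) (s φ) (e φ) =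
      2 * α * ⟪V (s φ), s φ⟫ * (‖V (s φ)‖ ^ 2 + 2 * P (s φ)) := by
  have hx := merid_ne_zero hs φ
  set L := fderiv ℝ (fun y => ‖V y‖ ^ 2 + 2 * P y) (s φ) with hL
  have hdB : DifferentiableAt ℝ (fun y => ‖V y‖ ^ 2 + 2 * P y) (s φ) :=
    (Shvydkoy2018.hasFDerivAt_bernoulliFn (h.differentiableAt_velocity hx)
      (h.differentiableAt_pressure hx)).differentiableAt
  have h0 : L (V (s φ)) = 0 := fderiv_bernoulliFn_velocity h hx
  have h1 : L (EuclideanSpace.single 1 (1 : ℝ)) = 0 := by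
    have := sin_mul_fderiv_scalar_single_one (isAxisymmetricScalar_bernoulliFn hax haxP) hs hdB
    exact (mul_eq_zero.mp this).resolve_left hφ
  have h2 : L (s φ) = -(2 * α) * (‖V (s φ)‖ ^ 2 + 2 * P (s φ)) :=
    h.fderiv_bernoulliFn_apply_self hx
  rw [frame_decomp hs he (V (s φ)) φ, map_add, map_add, map_smul, map_smul, map_smul, h1, h2,
    smul_eq_mul, smul_eq_mul, smul_eq_mul] at h0
  linarith

/-- **Shvydkoy (A1), bulk form: the incompressibility relation on the meridian.** With
`D = ⟪DV(s φ) e, e⟫` (so that `a' = D - f`), `f = ⟪V, s⟫`, `a = ⟪V, e⟫`: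
`D sin φ + (1-α) f sin φ + a cos φ = 0`, i.e. `(2-α) f + a' + a cot φ = 0`.
[cite: Shvydkoy2018, §5 (axisymmetric system, first equation)] -/
private theorem div_merid (h : IsHomogeneousSteadyEuler α V P) (hax : IsAxisymmetric V)
    (hs : ∀ φ, s φ = Real.sin φ • EuclideanSpace.single 0 (1 : ℝ) +
      Real.cos φ • EuclideanSpace.single 2 (1 : ℝ))
    (he : ∀ φ, e φ = Real.cos φ • EuclideanSpace.single 0 (1 : ℝ) -
      Real.sin φ • EuclideanSpace.single 2 (1 : ℝ)) (φ : ℝ) :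
    ⟪fderiv ℝ V (s φ) (e φ), e φ⟫ * Real.sin φ + (1 - α) * ⟪V (s φ), s φ⟫ * Real.sin φ
      + ⟪V (s φ), e φ⟫ * Real.cos φ = 0 := by
  have hx := merid_ne_zero hs φ
  have hdiv := h.divergence_eq_zero hx
  rw [divergence_eq_sum_inner_fderiv (EuclideanSpace.basisFun (Fin 3) ℝ), Fin.sum_univ_three]
    at hdiv
  simp only [EuclideanSpace.basisFun_apply] at hdiv
  set A := fderiv ℝ V (s φ) with hA
  obtain ⟨hE0, hE2⟩ := single_zero_two_eq hs he φ
  have hAs : A (s φ) = (-α) • V (s φ) := h.fderiv_velocity_apply_self hx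
  have hA1 : Real.sin φ • A (EuclideanSpace.single 1 (1 : ℝ)) = rotGen (V (s φ)) :=
    sin_smul_fderiv_velocity_single_one h hax hs φ
  -- the three diagonal entries
  have hV0 : V (s φ) 0 = Real.sin φ * ⟪V (s φ), s φ⟫ + Real.cos φ * ⟪V (s φ), e φ⟫ := by
    have := congrArg (fun w : EuclideanSpace ℝ (Fin 3) => ⟪V (s φ), w⟫) hE0
    simpa [inner_add_right, real_inner_smul_right, EuclideanSpace.inner_single_right] using this
  have d1 : Real.sin φ * ⟪EuclideanSpace.single 1 (1 : ℝ), A (EuclideanSpace.single 1 (1 : ℝ))⟫ =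
      Real.sin φ * ⟪V (s φ), s φ⟫ + Real.cos φ * ⟪V (s φ), e φ⟫ := by
    rw [← real_inner_smul_right, hA1, real_inner_comm, inner_single_one, rotGen_apply_one, hV0]
  have d02 : ⟪EuclideanSpace.single 0 (1 : ℝ), A (EuclideanSpace.single 0 (1 : ℝ))⟫ +
      ⟪EuclideanSpace.single 2 (1 : ℝ), A (EuclideanSpace.single 2 (1 : ℝ))⟫ =
      ⟪s φ, A (s φ)⟫ + ⟪e φ, A (e φ)⟫ := by
    rw [hE0, hE2]
    simp only [map_add, map_sub, map_smul, inner_add_left, inner_add_right, inner_sub_left,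
      inner_sub_right, real_inner_smul_left, real_inner_smul_right]
    linear_combination (⟪s φ, A (s φ)⟫ + ⟪e φ, A (e φ)⟫) * Real.sin_sq_add_cos_sq φ
  have dss : ⟪s φ, A (s φ)⟫ = -α * ⟪V (s φ), s φ⟫ := by
    rw [hAs, real_inner_smul_right, real_inner_comm]
  have dee : ⟪e φ, A (e φ)⟫ = ⟪A (e φ), e φ⟫ := real_inner_comm _ _
  have key : Real.sin φ * (⟪s φ, A (s φ)⟫ + ⟪e φ, A (e φ)⟫) +
      Real.sin φ * ⟪EuclideanSpace.single 1 (1 : ℝ), A (EuclideanSpace.single 1 (1 : ℝ))⟫ = 0 := by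
    have h3 : ⟪s φ, A (s φ)⟫ + ⟪e φ, A (e φ)⟫ +
        ⟪EuclideanSpace.single 1 (1 : ℝ), A (EuclideanSpace.single 1 (1 : ℝ))⟫ = 0 := by
      rw [← d02]; linarith [hdiv]
    rw [← mul_add, h3, mul_zero]
  rw [d1, dss, dee] at key
  linear_combination key

/-- **Shvydkoy (A2)–(A3) on the meridian where `a = 0` (bulk form).** If `⟪V, e⟫ = 0` at `s φ`
(`sin φ ≠ 0`) then, with `b = V₁`, `f = ⟪V, s⟫`, `p = P`:  `DP(s φ) e · sin φ = b² cos φ`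
((A3) with `a = 0`: `p' = b² cot φ`) and `b² + α f² + 2α p = 0` ((A2) with `a = 0`).
[cite: Shvydkoy2018, §5 (axisymmetric system, second and third equations)] -/
private theorem momentum_merid_of_a_eq_zero (h : IsHomogeneousSteadyEuler α V P)
    (hax : IsAxisymmetric V)
    (hs : ∀ φ, s φ = Real.sin φ • EuclideanSpace.single 0 (1 : ℝ) +
      Real.cos φ • EuclideanSpace.single 2 (1 : ℝ))
    (he : ∀ φ, e φ = Real.cos φ • EuclideanSpace.single 0 (1 : ℝ) -
      Real.sin φ • EuclideanSpace.single 2 (1 : ℝ)) {φ : ℝ} (hφ : Real.sin φ ≠ 0)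
    (ha : ⟪V (s φ), e φ⟫ = 0) :
    fderiv ℝ P (s φ) (e φ) * Real.sin φ = V (s φ) 1 ^ 2 * Real.cos φ ∧
      V (s φ) 1 ^ 2 + α * ⟪V (s φ), s φ⟫ ^ 2 + 2 * α * P (s φ) = 0 := by
  have hx := merid_ne_zero hs φ
  set A := fderiv ℝ V (s φ) with hA
  obtain ⟨hJe, hJs⟩ := inner_rotGen_frame hs he (V (s φ)) φ
  have hAs : A (s φ) = (-α) • V (s φ) := h.fderiv_velocity_apply_self hx
  have hA1 : Real.sin φ • A (EuclideanSpace.single 1 (1 : ℝ)) = rotGen (V (s φ)) :=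
    sin_smul_fderiv_velocity_single_one h hax hs φ
  have hPs : fderiv ℝ P (s φ) (s φ) = -(2 * α) * P (s φ) := h.fderiv_pressure_apply_self hx
  -- `V = b E₁ + f s` at the point, hence `sin • A V = b • J V + f sin • (-α V)`
  have hV : V (s φ) = V (s φ) 1 • EuclideanSpace.single 1 (1 : ℝ) + ⟪V (s φ), s φ⟫ • s φ := by
    have := frame_decomp hs he (V (s φ)) φ
    rw [ha, zero_smul, zero_add] at this
    exact this
  have hAV : Real.sin φ • A (V (s φ)) =
      V (s φ) 1 • rotGen (V (s φ)) + (Real.sin φ * ⟪V (s φ), s φ⟫) • ((-α) • V (s φ)) := by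
    conv_lhs => rw [hV]
    rw [map_add, map_smul, map_smul, smul_add, smul_comm (Real.sin φ) (V (s φ) 1), hA1, hAs,
      smul_smul]
  -- pair the momentum equation with `e` and with `s`
  have m_e : Real.sin φ * ⟪A (V (s φ)), e φ⟫ = -(Real.sin φ * fderiv ℝ P (s φ) (e φ)) := by
    rw [inner_fderiv_velocity_velocity h hx (e φ), mul_neg]
  have m_s : Real.sin φ * ⟪A (V (s φ)), s φ⟫ = Real.sin φ * (2 * α * P (s φ)) := by
    rw [inner_fderiv_velocity_velocity h hx (s φ), hPs]; ring
  rw [← real_inner_smul_left, hAV, inner_add_left, inner_smul_left, inner_smul_left,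
    inner_smul_left] at m_e m_s
  simp only [conj_trivial] at m_e m_s
  rw [hJe, ha] at m_e
  rw [hJs] at m_s
  constructor
  · linear_combination m_e
  · have key : Real.sin φ * (V (s φ) 1 ^ 2 + α * ⟪V (s φ), s φ⟫ ^ 2 + 2 * α * P (s φ)) = 0 := by
      linear_combination -m_s
    exact (mul_eq_zero.mp key).resolve_left hφ

end Pointwise

/-! ### The meridian functions `a`, `H` and their derivatives -/

section MeridianFunctions

variable {α : ℝ} {V : EuclideanSpace ℝ (Fin 3) → EuclideanSpace ℝ (Fin 3)}
  {P : EuclideanSpace ℝ (Fin 3) → ℝ} {s e : ℝ → EuclideanSpace ℝ (Fin 3)} {a H : ℝ → ℝ}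

/-- The velocity is continuous along the meridian. [folklore] -/
private theorem continuous_velocity_merid (h : IsHomogeneousSteadyEuler α V P)
    (hs : ∀ φ, s φ = Real.sin φ • EuclideanSpace.single 0 (1 : ℝ) +
      Real.cos φ • EuclideanSpace.single 2 (1 : ℝ)) : Continuous fun ψ => V (s ψ) :=
  h.contDiffOn_velocity.continuousOn.comp_continuous (contDiff_merid hs).continuous
    fun ψ => merid_ne_zero hs ψ

/-- The pressure is continuous along the meridian. [folklore] -/
private theorem continuous_pressure_merid (h : IsHomogeneousSteadyEuler α V P)
    (hs : ∀ φ, s φ = Real.sin φ • EuclideanSpace.single 0 (1 : ℝ) +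
      Real.cos φ • EuclideanSpace.single 2 (1 : ℝ)) : Continuous fun ψ => P (s ψ) :=
  h.contDiffOn_pressure.continuousOn.comp_continuous (contDiff_merid hs).continuous
    fun ψ => merid_ne_zero hs ψ

/-- `a = ⟪V∘s, e⟫` is continuous. [folklore] -/
private theorem continuous_a (h : IsHomogeneousSteadyEuler α V P)
    (hs : ∀ φ, s φ = Real.sin φ • EuclideanSpace.single 0 (1 : ℝ) +
      Real.cos φ • EuclideanSpace.single 2 (1 : ℝ))
    (he : ∀ φ, e φ = Real.cos φ • EuclideanSpace.single 0 (1 : ℝ) -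
      Real.sin φ • EuclideanSpace.single 2 (1 : ℝ))
    (ha : ∀ ψ, a ψ = ⟪V (s ψ), e ψ⟫) : Continuous a := by
  rw [show a = fun ψ => ⟪V (s ψ), e ψ⟫ from funext ha]
  exact (continuous_velocity_merid h hs).inner (contDiff_frame he).continuous

/-- `H = ‖V∘s‖² + 2 P∘s` is continuous. [folklore] -/
private theorem continuous_H (h : IsHomogeneousSteadyEuler α V P)
    (hs : ∀ φ, s φ = Real.sin φ • EuclideanSpace.single 0 (1 : ℝ) +
      Real.cos φ • EuclideanSpace.single 2 (1 : ℝ))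
    (hH : ∀ ψ, H ψ = ‖V (s ψ)‖ ^ 2 + 2 * P (s ψ)) : Continuous H := by
  rw [show H = fun ψ => ‖V (s ψ)‖ ^ 2 + 2 * P (s ψ) from funext hH]
  exact ((continuous_velocity_merid h hs).norm.pow 2).add
    (continuous_const.mul (continuous_pressure_merid h hs))

/-- `a' = ⟪DV(s) e, e⟫ - ⟪V(s), s⟫` (product rule, `s' = e`, `e' = -s`). [folklore] -/
private theorem hasDerivAt_a (h : IsHomogeneousSteadyEuler α V P)
    (hs : ∀ φ, s φ = Real.sin φ • EuclideanSpace.single 0 (1 : ℝ) +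
      Real.cos φ • EuclideanSpace.single 2 (1 : ℝ))
    (he : ∀ φ, e φ = Real.cos φ • EuclideanSpace.single 0 (1 : ℝ) -
      Real.sin φ • EuclideanSpace.single 2 (1 : ℝ))
    (ha : ∀ ψ, a ψ = ⟪V (s ψ), e ψ⟫) (φ : ℝ) :
    HasDerivAt a (⟪fderiv ℝ V (s φ) (e φ), e φ⟫ - ⟪V (s φ), s φ⟫) φ := by
  have hx := merid_ne_zero hs φ
  have hVs : HasDerivAt (fun ψ => V (s ψ)) (fderiv ℝ V (s φ) (e φ)) φ :=
    (h.differentiableAt_velocity hx).hasFDerivAt.comp_hasDerivAt φ (hasDerivAt_merid hs he φ)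
  rw [show a = fun ψ => ⟪V (s ψ), e ψ⟫ from funext ha]
  refine (hVs.inner ℝ (hasDerivAt_frame hs he φ)).congr_deriv ?_
  rw [inner_neg_right]
  ring

/-- `H' = D(‖V‖²+2P)(s) e` (chain rule). [folklore] -/
private theorem hasDerivAt_H (h : IsHomogeneousSteadyEuler α V P)
    (hs : ∀ φ, s φ = Real.sin φ • EuclideanSpace.single 0 (1 : ℝ) +
      Real.cos φ • EuclideanSpace.single 2 (1 : ℝ))
    (he : ∀ φ, e φ = Real.cos φ • EuclideanSpace.single 0 (1 : ℝ) -
      Real.sin φ • EuclideanSpace.single 2 (1 : ℝ))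
    (hH : ∀ ψ, H ψ = ‖V (s ψ)‖ ^ 2 + 2 * P (s ψ)) (φ : ℝ) :
    HasDerivAt H (fderiv ℝ (fun y => ‖V y‖ ^ 2 + 2 * P y) (s φ) (e φ)) φ := by
  have hx := merid_ne_zero hs φ
  have hdB : DifferentiableAt ℝ (fun y => ‖V y‖ ^ 2 + 2 * P y) (s φ) :=
    (Shvydkoy2018.hasFDerivAt_bernoulliFn (h.differentiableAt_velocity hx)
      (h.differentiableAt_pressure hx)).differentiableAt
  rw [show H = fun ψ => (fun y => ‖V y‖ ^ 2 + 2 * P y) (s ψ) from funext hH]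
  exact hdB.hasFDerivAt.comp_hasDerivAt φ (hasDerivAt_merid hs he φ)

/-- `(P∘s)' = DP(s) e` (chain rule). [folklore] -/
private theorem hasDerivAt_p (h : IsHomogeneousSteadyEuler α V P)
    (hs : ∀ φ, s φ = Real.sin φ • EuclideanSpace.single 0 (1 : ℝ) +
      Real.cos φ • EuclideanSpace.single 2 (1 : ℝ))
    (he : ∀ φ, e φ = Real.cos φ • EuclideanSpace.single 0 (1 : ℝ) -
      Real.sin φ • EuclideanSpace.single 2 (1 : ℝ)) (φ : ℝ) :
    HasDerivAt (fun ψ => P (s ψ)) (fderiv ℝ P (s φ) (e φ)) φ :=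
  (h.differentiableAt_pressure (merid_ne_zero hs φ)).hasFDerivAt.comp_hasDerivAt φ
    (hasDerivAt_merid hs he φ)

end MeridianFunctions

/-! ### Propagation along the meridian (private real-analysis plumbing) -/

/-- A function with zero derivative on an open set is locally constant there. [folklore] -/
private theorem eventually_eq_of_hasDerivAt_zero {Λ : ℝ → ℝ} {G : Set ℝ} (hG : IsOpen G)
    (hd : ∀ ψ ∈ G, HasDerivAt Λ 0 ψ) {ψ₀ : ℝ} (h0 : ψ₀ ∈ G) :
    ∀ᶠ ψ in 𝓝 ψ₀, Λ ψ = Λ ψ₀ := by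
  obtain ⟨ε, hε, hball⟩ := Metric.isOpen_iff.mp hG ψ₀ h0
  filter_upwards [Metric.ball_mem_nhds ψ₀ hε] with ψ hψ
  have key := Convex.norm_image_sub_le_of_norm_hasDerivWithin_le (f := Λ) (f' := fun _ => (0 : ℝ))
    (C := 0) (fun x hx => (hd x (hball hx)).hasDerivWithinAt) (fun x _ => by simp)
    (convex_ball ψ₀ ε) (Metric.mem_ball_self hε) hψ
  rw [zero_mul, norm_le_zero_iff, sub_eq_zero] at key
  exact key

/-- **Clopen propagation on `(0, π)`.** A continuous `K : ℝ → ℝ`, locally constant on an open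
`G ⊆ (0, π)` containing `φ₀`, such that every `φ ∈ (0, π)` with `K φ = K φ₀` lies in `G`, takes the
value `K φ₀` at `0` (the set `{φ ∈ G | K φ = K φ₀}` is clopen in the connected `(0, π)`, hence all
of it, and `0` lies in its closure). [folklore] -/
private theorem apply_zero_eq_of_locally_const {K : ℝ → ℝ} {G : Set ℝ} {φ₀ : ℝ}
    (hK : Continuous K) (hG : IsOpen G) (hGs : G ⊆ Ioo 0 Real.pi) (h0 : φ₀ ∈ G)
    (hloc : ∀ φ ∈ G, ∀ᶠ ψ in 𝓝 φ, K ψ = K φ)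
    (hback : ∀ φ ∈ Ioo 0 Real.pi, K φ = K φ₀ → φ ∈ G) : K 0 = K φ₀ := by
  set u : Set ℝ := {φ | φ ∈ G ∧ K φ = K φ₀} with hu
  have hu_open : IsOpen u := by
    rw [isOpen_iff_mem_nhds]
    rintro φ ⟨hφG, hφK⟩
    filter_upwards [hG.mem_nhds hφG, hloc φ hφG] with ψ hψG hψK
    exact ⟨hψG, hψK.trans hφK⟩
  have hclosed : IsClosed {φ : ℝ | K φ = K φ₀} := isClosed_eq hK continuous_const
  have hsub : Ioo 0 Real.pi ⊆ u := by
    refine isPreconnected_Ioo.subset_of_closure_inter_subset hu_open ⟨φ₀, hGs h0, h0, rfl⟩ ?_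
    rintro φ ⟨hφcl, hφI⟩
    have hKφ : K φ = K φ₀ :=
      (closure_minimal (fun ψ hψ => hψ.2) hclosed : closure u ⊆ {φ | K φ = K φ₀}) hφcl
    exact ⟨hback φ hφI hKφ, hKφ⟩
  have hcl : closure (Ioo 0 Real.pi) ⊆ {φ : ℝ | K φ = K φ₀} :=
    closure_minimal (fun ψ hψ => (hsub hψ).2) hclosed
  have h0cl : (0 : ℝ) ∈ closure (Ioo 0 Real.pi) := by
    rw [closure_Ioo Real.pi_pos.ne]
    exact ⟨le_rfl, Real.pi_pos.le⟩
  exact hcl h0cl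

/-! ### Step 1: `a H ≡ 0` on the meridian (first conservation law `|H|^{2-α}|a sin φ|^{2α} = B`) -/

section ConservationLaws

variable {α : ℝ} {V : EuclideanSpace ℝ (Fin 3) → EuclideanSpace ℝ (Fin 3)}
  {P : EuclideanSpace ℝ (Fin 3) → ℝ} {s e : ℝ → EuclideanSpace ℝ (Fin 3)} {a H : ℝ → ℝ}

/-- **Shvydkoy 2018, proof of Prop. 5.1, first half**: for `0 < α < 2`, at every point of the open
meridian `φ ∈ (0, π)` either `a = 0` or `H = 0`.  Printed: "If `aH ≠ 0` on some interval `I`, then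
we immediately obtain from [(CL2) `|H|^{2-α}|a sin φ|^{2α} = B`] that `I = (0,π)`, and since
`sin φ` vanishes, `H` becomes unbounded, which is a contradiction."  Here the conserved quantity is
`K = (H²)^{(2-α)/2} ((a sin φ)²)^α`, locally constant where `aH ≠ 0` because its logarithm has zero
derivative by (A1) and (AH), continuous on `ℝ` and vanishing at `φ = 0`.
[cite: Shvydkoy2018, Prop. 5.1 (proof, first conservation-law argument)] -/
private theorem a_eq_zero_or_H_eq_zero (h : IsHomogeneousSteadyEuler α V P)
    (hax : IsAxisymmetric V) (haxP : IsAxisymmetricScalar P)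
    (hs : ∀ φ, s φ = Real.sin φ • EuclideanSpace.single 0 (1 : ℝ) +
      Real.cos φ • EuclideanSpace.single 2 (1 : ℝ))
    (he : ∀ φ, e φ = Real.cos φ • EuclideanSpace.single 0 (1 : ℝ) -
      Real.sin φ • EuclideanSpace.single 2 (1 : ℝ))
    (h0 : 0 < α) (h2 : α < 2)
    (ha : ∀ ψ, a ψ = ⟪V (s ψ), e ψ⟫) (hH : ∀ ψ, H ψ = ‖V (s ψ)‖ ^ 2 + 2 * P (s ψ))
    {φ : ℝ} (hφ : φ ∈ Ioo 0 Real.pi) : a φ = 0 ∨ H φ = 0 := by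
  rcases eq_or_ne (a φ) 0 with ha0 | haφ
  · exact Or.inl ha0
  rcases eq_or_ne (H φ) 0 with hH0 | hHφ
  · exact Or.inr hH0
  exfalso
  have hac : Continuous a := continuous_a h hs he ha
  have hHc : Continuous H := continuous_H h hs hH
  have hq : 0 < (2 - α) / 2 := by linarith
  -- the open set where `aH ≠ 0`
  set G : Set ℝ := Ioo 0 Real.pi ∩ ({ψ | a ψ ≠ 0} ∩ {ψ | H ψ ≠ 0}) with hG
  have hGo : IsOpen G :=
    isOpen_Ioo.inter ((isOpen_ne_fun hac continuous_const).inter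
      (isOpen_ne_fun hHc continuous_const))
  have hGs : G ⊆ Ioo 0 Real.pi := inter_subset_left
  have hφG : φ ∈ G := ⟨hφ, haφ, hHφ⟩
  -- the conserved quantity and its logarithm
  set K : ℝ → ℝ := fun ψ =>
    (H ψ ^ 2) ^ ((2 - α) / 2) * ((a ψ * Real.sin ψ) ^ 2) ^ α with hK
  set Λ : ℝ → ℝ := fun ψ =>
    Real.log (H ψ ^ 2) * ((2 - α) / 2) + Real.log ((a ψ * Real.sin ψ) ^ 2) * α with hΛ
  have hKc : Continuous K :=
    ((hHc.pow 2).rpow_const fun _ => Or.inr hq.le).mul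
      (((hac.mul Real.continuous_sin).pow 2).rpow_const fun _ => Or.inr h0.le)
  have hKexp : ∀ ψ ∈ G, K ψ = Real.exp (Λ ψ) := by
    rintro ψ ⟨hI, haψ, hHψ⟩
    have hs0 : Real.sin ψ ≠ 0 := (Real.sin_pos_of_pos_of_lt_pi hI.1 hI.2).ne'
    have h1 : 0 < H ψ ^ 2 := sq_pos_of_ne_zero hHψ
    have h2' : 0 < (a ψ * Real.sin ψ) ^ 2 := sq_pos_of_ne_zero (mul_ne_zero haψ hs0)
    simp only [hK, hΛ]
    rw [Real.rpow_def_of_pos h1, Real.rpow_def_of_pos h2', ← Real.exp_add]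
  -- the logarithm has zero derivative where `aH ≠ 0`: Shvydkoy's closed differential
  have hΛd : ∀ ψ ∈ G, HasDerivAt Λ 0 ψ := by
    rintro ψ ⟨hI, haψ, hHψ⟩
    have hs0 : Real.sin ψ ≠ 0 := (Real.sin_pos_of_pos_of_lt_pi hI.1 hI.2).ne'
    have hH' := hasDerivAt_H h hs he hH ψ
    have ha' := hasDerivAt_a h hs he ha ψ
    set L := fderiv ℝ (fun y => ‖V y‖ ^ 2 + 2 * P y) (s ψ) (e ψ) with hL
    set D := ⟪fderiv ℝ V (s ψ) (e ψ), e ψ⟫ with hD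
    set f := ⟪V (s ψ), s ψ⟫ with hf
    -- (AH): a H' = 2α f H, and (A1): D sin + (1-α) f sin + a cos = 0
    have odeA : a ψ * L = 2 * α * f * H ψ := by
      rw [ha, hH]; exact bernoulli_transport_merid h hax haxP hs he hs0
    have odeB : D * Real.sin ψ + (1 - α) * f * Real.sin ψ + a ψ * Real.cos ψ = 0 := by
      rw [ha]; exact div_merid h hax hs he ψ
    have hH2 : HasDerivAt (fun y => H y ^ 2) (2 * H ψ * L) ψ :=
      (hH'.pow 2).congr_deriv (by norm_num)
    have has2 : HasDerivAt (fun y => (a y * Real.sin y) ^ 2)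
        (2 * (a ψ * Real.sin ψ) * ((D - f) * Real.sin ψ + a ψ * Real.cos ψ)) ψ :=
      ((ha'.mul (Real.hasDerivAt_sin ψ)).pow 2).congr_deriv (by norm_num)
    have hlog1 := hH2.log (pow_ne_zero 2 hHψ)
    have hlog2 := has2.log (pow_ne_zero 2 (mul_ne_zero haψ hs0))
    have hΛ' := (hlog1.mul_const ((2 - α) / 2)).add (hlog2.mul_const α)
    refine hΛ'.congr_deriv ?_
    rw [div_mul_eq_mul_div, div_mul_eq_mul_div,
      div_add_div _ _ (pow_ne_zero 2 hHψ) (pow_ne_zero 2 (mul_ne_zero haψ hs0)),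
      div_eq_zero_iff]
    left
    linear_combination (2 * ((2 - α) / 2) * H ψ * a ψ * Real.sin ψ ^ 2) * odeA +
      (2 * α * a ψ * Real.sin ψ * H ψ ^ 2) * odeB
  -- hence `K` is locally constant on `G`
  have hloc : ∀ ψ₀ ∈ G, ∀ᶠ ψ in 𝓝 ψ₀, K ψ = K ψ₀ := by
    intro ψ₀ hψ₀
    filter_upwards [hGo.mem_nhds hψ₀, eventually_eq_of_hasDerivAt_zero hGo hΛd hψ₀]
      with ψ hψG hψΛ
    rw [hKexp ψ hψG, hKexp ψ₀ hψ₀, hψΛ]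
  -- `K = K φ > 0` forces `aH ≠ 0`
  have hKpos : 0 < K φ := by
    have hs0 : Real.sin φ ≠ 0 := (Real.sin_pos_of_pos_of_lt_pi hφ.1 hφ.2).ne'
    exact mul_pos (Real.rpow_pos_of_pos (sq_pos_of_ne_zero hHφ) _)
      (Real.rpow_pos_of_pos (sq_pos_of_ne_zero (mul_ne_zero haφ hs0)) _)
  have hback : ∀ ψ ∈ Ioo 0 Real.pi, K ψ = K φ → ψ ∈ G := by
    intro ψ hI hKψ
    refine ⟨hI, ?_, ?_⟩
    · intro ha0
      have : K ψ = 0 := by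
        simp only [hK, ha0, zero_mul, ne_eq, OfNat.ofNat_ne_zero, not_false_eq_true, zero_pow,
          Real.zero_rpow h0.ne', mul_zero]
      rw [this] at hKψ
      exact (ne_of_gt hKpos) hKψ.symm
    · intro hH0
      have : K ψ = 0 := by
        simp only [hK, hH0, ne_eq, OfNat.ofNat_ne_zero, not_false_eq_true, zero_pow,
          Real.zero_rpow hq.ne', zero_mul]
      rw [this] at hKψ
      exact (ne_of_gt hKpos) hKψ.symm
  -- propagate to the pole `φ = 0`, where `K = 0` because `sin 0 = 0`
  have hK0 : K 0 = 0 := by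
    simp only [hK, Real.sin_zero, mul_zero, ne_eq, OfNat.ofNat_ne_zero, not_false_eq_true,
      zero_pow, Real.zero_rpow h0.ne', mul_zero]
  have hprop := apply_zero_eq_of_locally_const hKc hGo hGs hφG hloc hback
  rw [hK0] at hprop
  exact (ne_of_gt hKpos) hprop.symm

/-! ### Step 2: `H ≡ 0` on the open meridian (second conservation law `H sin^{2α} φ = C`) -/

/-- **Shvydkoy 2018, proof of Prop. 5.1, second half**: for `0 < α < 2`, `α ≠ 1`, the Bernoulli
function vanishes on the open meridian `φ ∈ (0, π)`.  Printed: "Then `aH = 0` everywhere. Suppose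
`H ≠ 0` on some interval `I`. Then `a = 0`, and from [(A1)], `f = 0`. The entire system reduces to
[(T)] with explicit solutions [(TS): `b = A/sin^α φ`, `p = -A/(2α sin^{2α} φ)`]. These imply that
`I = (0,π)` since `H` stays bounded away from zero. Hence `H` blows up, which is a contradiction."
Here the conserved quantity is `K₂ = H² (sin² φ)^{2α}`, locally constant where `H ≠ 0` (there
`a = f = 0`, `b² + 2αp = 0`, `p' sin φ = b² cos φ`, `H = 2(1-α)p`), continuous on `ℝ` and
vanishing at `φ = 0`. [cite: Shvydkoy2018, Prop. 5.1 (proof, second argument) and Prop. 4.1] -/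
private theorem H_eq_zero_of_mem_Ioo (h : IsHomogeneousSteadyEuler α V P)
    (hax : IsAxisymmetric V) (haxP : IsAxisymmetricScalar P)
    (hs : ∀ φ, s φ = Real.sin φ • EuclideanSpace.single 0 (1 : ℝ) +
      Real.cos φ • EuclideanSpace.single 2 (1 : ℝ))
    (he : ∀ φ, e φ = Real.cos φ • EuclideanSpace.single 0 (1 : ℝ) -
      Real.sin φ • EuclideanSpace.single 2 (1 : ℝ))
    (h0 : 0 < α) (h1 : α ≠ 1) (h2 : α < 2)
    (ha : ∀ ψ, a ψ = ⟪V (s ψ), e ψ⟫) (hH : ∀ ψ, H ψ = ‖V (s ψ)‖ ^ 2 + 2 * P (s ψ))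
    {φ : ℝ} (hφ : φ ∈ Ioo 0 Real.pi) : H φ = 0 := by
  by_contra hHφ
  have hHc : Continuous H := continuous_H h hs hH
  -- the open set where `H ≠ 0`; there `a = 0` by Step 1
  set Z : Set ℝ := Ioo 0 Real.pi ∩ {ψ | H ψ ≠ 0} with hZ
  have hZo : IsOpen Z := isOpen_Ioo.inter (isOpen_ne_fun hHc continuous_const)
  have hZs : Z ⊆ Ioo 0 Real.pi := inter_subset_left
  have hφZ : φ ∈ Z := ⟨hφ, hHφ⟩
  have haZ : ∀ ψ ∈ Z, a ψ = 0 := fun ψ hψ =>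
    (a_eq_zero_or_H_eq_zero h hax haxP hs he h0 h2 ha hH hψ.1).resolve_right hψ.2
  -- on `Z`: `f = 0`, `b² + 2αp = 0`, `p' sin = b² cos`, `H = 2(1-α) p`
  have hrel : ∀ ψ ∈ Z, ⟪V (s ψ), s ψ⟫ = 0 ∧
      V (s ψ) 1 ^ 2 + 2 * α * P (s ψ) = 0 ∧
      fderiv ℝ P (s ψ) (e ψ) * Real.sin ψ = V (s ψ) 1 ^ 2 * Real.cos ψ ∧
      H ψ = 2 * (1 - α) * P (s ψ) := by
    intro ψ hψ
    have hs0 : Real.sin ψ ≠ 0 := (Real.sin_pos_of_pos_of_lt_pi hψ.1.1 hψ.1.2).ne'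
    have ha0 : ⟪V (s ψ), e ψ⟫ = 0 := by rw [← ha]; exact haZ ψ hψ
    -- `a ≡ 0` near `ψ`, so `a' = 0`, i.e. `D = f`
    have hev : a =ᶠ[𝓝 ψ] fun _ => (0 : ℝ) :=
      Filter.eventually_of_mem (hZo.mem_nhds hψ) fun y hy => haZ y hy
    have hDf : ⟪fderiv ℝ V (s ψ) (e ψ), e ψ⟫ - ⟪V (s ψ), s ψ⟫ = 0 :=
      (hasDerivAt_a h hs he ha ψ).unique ((hasDerivAt_const ψ (0 : ℝ)).congr_of_eventuallyEq hev)
    have odeB := div_merid h hax hs he ψ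
    rw [ha0, zero_mul, add_zero] at odeB
    have hf0 : ⟪V (s ψ), s ψ⟫ = 0 := by
      have key : (2 - α) * Real.sin ψ * ⟪V (s ψ), s ψ⟫ = 0 := by
        linear_combination odeB - Real.sin ψ * hDf
      rcases mul_eq_zero.mp key with hk | hk
      · rcases mul_eq_zero.mp hk with hk' | hk'
        · exact absurd hk' (by linarith)
        · exact absurd hk' hs0
      · exact hk
    obtain ⟨hC1, hC2⟩ := momentum_merid_of_a_eq_zero h hax hs he hs0 ha0
    rw [hf0] at hC2
    have hC2' : V (s ψ) 1 ^ 2 + 2 * α * P (s ψ) = 0 := by linear_combination hC2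
    refine ⟨hf0, hC2', hC1, ?_⟩
    rw [hH, norm_sq_frame hs he (V (s ψ)) ψ, ha0, hf0]
    linear_combination hC2'
  -- the conserved quantity and its logarithm
  set K : ℝ → ℝ := fun ψ => H ψ ^ 2 * (Real.sin ψ ^ 2) ^ (2 * α) with hK
  set Λ : ℝ → ℝ := fun ψ => Real.log (H ψ ^ 2) + Real.log (Real.sin ψ ^ 2) * (2 * α) with hΛ
  have h2α : 0 < 2 * α := by linarith
  have hKc : Continuous K :=
    (hHc.pow 2).mul ((Real.continuous_sin.pow 2).rpow_const fun _ => Or.inr h2α.le)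
  have hKexp : ∀ ψ ∈ Z, K ψ = Real.exp (Λ ψ) := by
    rintro ψ ⟨hI, hHψ⟩
    have hsq : 0 < Real.sin ψ ^ 2 := sq_pos_of_ne_zero (Real.sin_pos_of_pos_of_lt_pi hI.1 hI.2).ne'
    have h1' : 0 < H ψ ^ 2 := sq_pos_of_ne_zero hHψ
    simp only [hK, hΛ]
    rw [Real.rpow_def_of_pos hsq, ← Real.exp_log h1', ← Real.exp_add, Real.log_exp]
  have hΛd : ∀ ψ ∈ Z, HasDerivAt Λ 0 ψ := by
    intro ψ hψ
    have hs0 : Real.sin ψ ≠ 0 := (Real.sin_pos_of_pos_of_lt_pi hψ.1.1 hψ.1.2).ne'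
    have hHψ : H ψ ≠ 0 := hψ.2
    obtain ⟨-, hC2, hC1, hHP⟩ := hrel ψ hψ
    set p' := fderiv ℝ P (s ψ) (e ψ) with hp'
    -- `H = 2(1-α) P∘s` near `ψ`, so `H' = 2(1-α) p'`
    have hev : H =ᶠ[𝓝 ψ] fun y => 2 * (1 - α) * P (s y) :=
      Filter.eventually_of_mem (hZo.mem_nhds hψ) fun y hy => (hrel y hy).2.2.2
    have hH' : HasDerivAt H (2 * (1 - α) * p') ψ :=
      ((hasDerivAt_p h hs he ψ).const_mul (2 * (1 - α))).congr_of_eventuallyEq hev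
    have hH2 : HasDerivAt (fun y => H y ^ 2) (2 * H ψ * (2 * (1 - α) * p')) ψ :=
      (hH'.pow 2).congr_deriv (by norm_num)
    have hsin2 : HasDerivAt (fun y => Real.sin y ^ 2) (2 * Real.sin ψ * Real.cos ψ) ψ :=
      ((Real.hasDerivAt_sin ψ).pow 2).congr_deriv (by norm_num)
    have hlog1 := hH2.log (pow_ne_zero 2 hHψ)
    have hlog2 := hsin2.log (pow_ne_zero 2 hs0)
    have hΛ' := hlog1.add (hlog2.mul_const (2 * α))
    refine hΛ'.congr_deriv ?_
    have hPne : P (s ψ) ≠ 0 := by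
      intro hP0
      rw [hP0, mul_zero] at hHP
      exact hHψ hHP
    rw [hHP, div_mul_eq_mul_div,
      div_add_div _ _ (pow_ne_zero 2 (by
        refine mul_ne_zero (mul_ne_zero two_ne_zero ?_) hPne
        exact sub_ne_zero.mpr (Ne.symm h1))) (pow_ne_zero 2 hs0),
      div_eq_zero_iff]
    left
    linear_combination (8 * (1 - α) ^ 2 * P (s ψ) * Real.sin ψ) * hC1 +
      (8 * (1 - α) ^ 2 * P (s ψ) * Real.sin ψ * Real.cos ψ) * hC2
  have hloc : ∀ ψ₀ ∈ Z, ∀ᶠ ψ in 𝓝 ψ₀, K ψ = K ψ₀ := by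
    intro ψ₀ hψ₀
    filter_upwards [hZo.mem_nhds hψ₀, eventually_eq_of_hasDerivAt_zero hZo hΛd hψ₀]
      with ψ hψG hψΛ
    rw [hKexp ψ hψG, hKexp ψ₀ hψ₀, hψΛ]
  have hKpos : 0 < K φ :=
    mul_pos (sq_pos_of_ne_zero hHφ)
      (Real.rpow_pos_of_pos (sq_pos_of_ne_zero (Real.sin_pos_of_pos_of_lt_pi hφ.1 hφ.2).ne') _)
  have hback : ∀ ψ ∈ Ioo 0 Real.pi, K ψ = K φ → ψ ∈ Z := by
    intro ψ hI hKψ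
    refine ⟨hI, ?_⟩
    intro hH0
    have : K ψ = 0 := by
      simp only [hK, hH0, ne_eq, OfNat.ofNat_ne_zero, not_false_eq_true, zero_pow, zero_mul]
    rw [this] at hKψ
    exact (ne_of_gt hKpos) hKψ.symm
  have hK0 : K 0 = 0 := by
    simp only [hK, Real.sin_zero, ne_eq, OfNat.ofNat_ne_zero, not_false_eq_true, zero_pow,
      Real.zero_rpow h2α.ne', mul_zero]
  have hprop := apply_zero_eq_of_locally_const hKc hZo hZs hφZ hloc hback
  rw [hK0] at hprop
  exact (ne_of_gt hKpos) hprop.symm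

end ConservationLaws

/-! ### Every direction is a rotated meridian direction -/

/-- Spherical coordinates: every `y ≠ 0` in `ℝ³` is `‖y‖ · R_θ (sin φ, 0, cos φ)` with
`φ ∈ [0, π]`. [folklore] -/
private theorem exists_rotZ_merid {s : ℝ → EuclideanSpace ℝ (Fin 3)}
    (hs : ∀ φ, s φ = Real.sin φ • EuclideanSpace.single 0 (1 : ℝ) +
      Real.cos φ • EuclideanSpace.single 2 (1 : ℝ))
    {y : EuclideanSpace ℝ (Fin 3)} (hy : y ≠ 0) :
    ∃ θ φ : ℝ, φ ∈ Icc 0 Real.pi ∧ y = ‖y‖ • rotZ θ (s φ) := by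
  have hn : 0 < ‖y‖ := norm_pos_iff.mpr hy
  set u : EuclideanSpace ℝ (Fin 3) := ‖y‖⁻¹ • y with hu
  have hu1 : ‖u‖ = 1 := norm_smul_inv_norm hy
  have husq : u 0 ^ 2 + u 1 ^ 2 + u 2 ^ 2 = 1 := by
    rw [← norm_sq_fin3, hu1, one_pow]
  have hu2a : -1 ≤ u 2 := by nlinarith [sq_nonneg (u 0), sq_nonneg (u 1)]
  have hu2b : u 2 ≤ 1 := by nlinarith [sq_nonneg (u 0), sq_nonneg (u 1)]
  set z : ℂ := ⟨u 0, u 1⟩ with hz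
  have hzn : ‖z‖ = Real.sin (Real.arccos (u 2)) := by
    rw [Real.sin_arccos, Complex.norm_def, Complex.normSq_mk]
    congr 1
    nlinarith [husq]
  refine ⟨Complex.arg z, Real.arccos (u 2), ⟨Real.arccos_nonneg _, Real.arccos_le_pi _⟩, ?_⟩
  have hrot : rotZ (Complex.arg z) (s (Real.arccos (u 2))) = u := by
    obtain ⟨h0', h1', h2'⟩ := merid_apply hs (Real.arccos (u 2))
    ext i
    fin_cases i
    · show rotZ (Complex.arg z) (s (Real.arccos (u 2))) 0 = u 0
      rw [rotZ_apply_zero, h0', h1', mul_zero, sub_zero, ← hzn, mul_comm, Complex.norm_mul_cos_arg]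
    · show rotZ (Complex.arg z) (s (Real.arccos (u 2))) 1 = u 1
      rw [rotZ_apply_one, h0', h1', mul_zero, add_zero, ← hzn, mul_comm, Complex.norm_mul_sin_arg]
    · show rotZ (Complex.arg z) (s (Real.arccos (u 2))) 2 = u 2
      rw [rotZ_apply_two, h2', Real.cos_arccos hu2a hu2b]
  rw [hrot, hu, smul_smul, mul_inv_cancel₀ hn.ne', one_smul]

/-! ### The theorems -/

variable {α : ℝ} {V : EuclideanSpace ℝ (Fin 3) → EuclideanSpace ℝ (Fin 3)}
  {P : EuclideanSpace ℝ (Fin 3) → ℝ}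

/-- **Shvydkoy 2018, proof of Prop. 5.1: "We have proved that `H = 0` on the entire sphere"**
(arXiv:1510.03378 p. 11), in bulk form and for the whole printed range except `α = 1`: a `C¹`
homogeneous stationary Euler pair on `ℝ³ ∖ {0}` of degree `-α`, `0 < α < 2`, `α ≠ 1`, which is
axisymmetric (`V`, `P` invariant under the rotations about the `x₂`-axis) has vanishing Bernoulli
function: `‖V x‖² + 2 P x = 0` for every `x ≠ 0`.  (Proof: the two conservation laws along the
meridian, `a_eq_zero_or_H_eq_zero` and `H_eq_zero_of_mem_Ioo`; continuity at the poles;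
axisymmetry and homogeneity of the Bernoulli function.  At `α = 1` every `C¹` solution is trivial
anyway, `shvydkoy_homogeneousSteadyEuler_alpha_one_holds`.)  This is the input of BOTH halves of
Prop. 5.1: the window `1 < α < 2` below, and the range `0 < α < 1` (Props. 3.1–3.2, not in this
file). [cite: Shvydkoy2018, Prop. 5.1 (proof)] -/
theorem bernoulliFn_eq_zero_of_isAxisymmetric (h : IsHomogeneousSteadyEuler α V P)
    (hax : IsAxisymmetric V) (haxP : IsAxisymmetricScalar P) (h0 : 0 < α) (h1 : α ≠ 1)
    (h2 : α < 2) ⦃x : EuclideanSpace ℝ (Fin 3)⦄ (hx : x ≠ 0) : ‖V x‖ ^ 2 + 2 * P x = 0 := by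
  -- the meridian frame and functions
  set s : ℝ → EuclideanSpace ℝ (Fin 3) := fun φ =>
    Real.sin φ • EuclideanSpace.single 0 (1 : ℝ) + Real.cos φ • EuclideanSpace.single 2 (1 : ℝ)
    with hs_def
  set e : ℝ → EuclideanSpace ℝ (Fin 3) := fun φ =>
    Real.cos φ • EuclideanSpace.single 0 (1 : ℝ) - Real.sin φ • EuclideanSpace.single 2 (1 : ℝ)
    with he_def
  have hs : ∀ φ, s φ = Real.sin φ • EuclideanSpace.single 0 (1 : ℝ) +
      Real.cos φ • EuclideanSpace.single 2 (1 : ℝ) := fun φ => rfl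
  have he : ∀ φ, e φ = Real.cos φ • EuclideanSpace.single 0 (1 : ℝ) -
      Real.sin φ • EuclideanSpace.single 2 (1 : ℝ) := fun φ => rfl
  set a : ℝ → ℝ := fun ψ => ⟪V (s ψ), e ψ⟫ with ha_def
  set H : ℝ → ℝ := fun ψ => ‖V (s ψ)‖ ^ 2 + 2 * P (s ψ) with hH_def
  have ha : ∀ ψ, a ψ = ⟪V (s ψ), e ψ⟫ := fun ψ => rfl
  have hH : ∀ ψ, H ψ = ‖V (s ψ)‖ ^ 2 + 2 * P (s ψ) := fun ψ => rfl
  -- `H = 0` on the open meridian, then on the closed one by continuity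
  have hIoo : ∀ φ ∈ Ioo 0 Real.pi, H φ = 0 := fun φ hφ =>
    H_eq_zero_of_mem_Ioo h hax haxP hs he h0 h1 h2 ha hH hφ
  have hIcc : ∀ φ ∈ Icc 0 Real.pi, H φ = 0 := by
    have hcl : closure (Ioo 0 Real.pi) ⊆ {φ : ℝ | H φ = 0} :=
      closure_minimal hIoo (isClosed_eq (continuous_H h hs hH) continuous_const)
    rw [closure_Ioo Real.pi_pos.ne] at hcl
    exact hcl
  -- every direction is a rotated meridian direction (axisymmetry + homogeneity)
  obtain ⟨θ, φ, hφ, hxeq⟩ := exists_rotZ_merid hs hx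
  have hrot0 : rotZ θ (s φ) ≠ 0 := by
    intro h0'
    have := norm_rotZ θ (s φ)
    rw [h0', norm_zero] at this
    have h1' := norm_sq_merid hs φ
    rw [← this] at h1'
    norm_num at h1'
  have hB1 : ‖V (rotZ θ (s φ))‖ ^ 2 + 2 * P (rotZ θ (s φ)) = 0 := by
    have := isAxisymmetricScalar_bernoulliFn hax haxP θ (s φ)
    simp only at this
    rw [this]
    exact hIcc φ hφ
  rw [hxeq, h.bernoulliFn_smul_eq (norm_pos_iff.mpr hx) hrot0, hB1, mul_zero]

/-- **Shvydkoy 2018, Prop. 5.1 in the window `1 < α < 2`** (Trans. AMS 370 (2018), §5 =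
arXiv:1510.03378 p. 11: "There are no `C²` axisymmetric solutions in the range `0 < α < 2`"),
PROVED for the sub-range `1 < α < 2` and for the tree's `C¹` class: a `C¹` stationary Euler pair
`(V, P)` on `ℝ³ ∖ {0}`, homogeneous of degrees `-α` (velocity) and `-2α` (pressure) with
`1 < α < 2`, axisymmetric (`V (R_θ x) = R_θ V x`, `P (R_θ x) = P x`, with or without swirl), is
trivial: `V ≡ 0` off the origin.  Proof (the printed one, arXiv p. 11): the two conservation laws
`|H|^{2-α}|a sin φ|^{2α} = B` and `H sin^{2α} φ = C` along the meridian force the spherical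
Bernoulli function `H = |v|² + f² + 2p` to vanish on `S²`
(`bernoulliFn_eq_zero_of_isAxisymmetric`); then, for `1 < α < 2`, `(2-α)∫f² = (1-α)∫|v|²` gives
`V = 0` (`IsHomogeneousSteadyEuler.eq_zero_of_bernoulli_eq_zero`, Prop. 3.2).  The printed range
`0 < α ≤ 1` needs Props. 3.1–3.2 for `α < 1` (irrotationality and the Laplace–Beltrami spectrum)
and is NOT proved here — it is the named fact `shvydkoy2018_prop51_noAxisymmetric`
(`HomogeneousEulerAxisymmetric.lean`), of which this theorem is the window half
(`shvydkoy2018_prop51_noAxisymmetric_of_one_lt`). [cite: Shvydkoy2018, Prop. 5.1] -/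
theorem eq_zero_of_isAxisymmetric (h : IsHomogeneousSteadyEuler α V P) (hax : IsAxisymmetric V)
    (haxP : IsAxisymmetricScalar P) (h1 : 1 < α) (h2 : α < 2)
    ⦃x : EuclideanSpace ℝ (Fin 3)⦄ (hx : x ≠ 0) : V x = 0 :=
  h.eq_zero_of_bernoulli_eq_zero h1 (by rw [finrank_euclideanSpace_fin]; norm_num; linarith)
    (fun _ hy => h.bernoulliFn_eq_zero_of_isAxisymmetric hax haxP (by linarith) (by linarith) h2 hy)
    hx

/-! ### Public meridian interface: Shvydkoy's axisymmetric system for all `α` (for the complementary range `0 < α < 1`) -/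

section MeridianInterface

variable {s e : ℝ → EuclideanSpace ℝ (Fin 3)} {a b f p H : ℝ → ℝ}

/-! The meridian functions of `(V, P)`: with `s φ = sin φ · E₀ + cos φ · E₂` (the meridian
`θ = 0` of the unit sphere by polar angle) and `e φ = cos φ · E₀ - sin φ · E₂ = s'(φ)`,
`a = ⟪V∘s, e⟫`, `b = (V∘s)₁`, `f = ⟪V∘s, s⟫`, `p = P∘s`, `H = ‖V∘s‖² + 2 P∘s` are Shvydkoy's
`a, b, f, p, H` of §5 restricted to the meridian (all characterised by hypotheses, to be
instantiated with `rfl`). -/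

/-- Zeroth Cartesian component of the velocity on the meridian: `V₀ = f sin φ + a cos φ`. [folklore] -/
private theorem velocity_apply_zero
    (hs : ∀ φ, s φ = Real.sin φ • EuclideanSpace.single 0 (1 : ℝ) +
      Real.cos φ • EuclideanSpace.single 2 (1 : ℝ))
    (he : ∀ φ, e φ = Real.cos φ • EuclideanSpace.single 0 (1 : ℝ) -
      Real.sin φ • EuclideanSpace.single 2 (1 : ℝ)) (φ : ℝ) :
    V (s φ) 0 = Real.sin φ * ⟪V (s φ), s φ⟫ + Real.cos φ * ⟪V (s φ), e φ⟫ := by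
  have := congrArg (fun w : EuclideanSpace ℝ (Fin 3) => ⟪V (s φ), w⟫) (single_zero_two_eq hs he φ).1
  simpa [inner_add_right, real_inner_smul_right, EuclideanSpace.inner_single_right] using this

/-- **The spherical Bernoulli function on the meridian**: `H = a² + b² + f² + 2p`
(`H = |v|² + f² + 2p` with `|v|² = a² + b²`). [cite: Shvydkoy2018, §2 (definition of H) and §5] -/
theorem meridian_bernoulli_eq
    (hs : ∀ φ, s φ = Real.sin φ • EuclideanSpace.single 0 (1 : ℝ) +
      Real.cos φ • EuclideanSpace.single 2 (1 : ℝ))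
    (he : ∀ φ, e φ = Real.cos φ • EuclideanSpace.single 0 (1 : ℝ) -
      Real.sin φ • EuclideanSpace.single 2 (1 : ℝ))
    (ha : ∀ ψ, a ψ = ⟪V (s ψ), e ψ⟫) (hb : ∀ ψ, b ψ = V (s ψ) 1) (hf : ∀ ψ, f ψ = ⟪V (s ψ), s ψ⟫)
    (hp : ∀ ψ, p ψ = P (s ψ)) (hH : ∀ ψ, H ψ = ‖V (s ψ)‖ ^ 2 + 2 * P (s ψ)) (φ : ℝ) :
    H φ = a φ ^ 2 + b φ ^ 2 + f φ ^ 2 + 2 * p φ := by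
  rw [hH, ha, hb, hf, hp, norm_sq_frame hs he (V (s φ)) φ]

/-- **Derivatives of the meridian functions** (chain and product rules, `s' = e`, `e' = -s`):
`a' = ⟪DV e, e⟫ - f`, `b' = (DV e)₁`, `f' = ⟪DV e, s⟫ + a`, `p' = DP e`, `H' = D(‖V‖²+2P) e`,
all at `s φ`; in particular `a, b, f, p, H` are `C¹` functions of the polar angle ("`a, b, f,
p ∈ C¹`", §5). [cite: Shvydkoy2018, §5 (the axisymmetric ansatz)] -/
theorem meridian_hasDerivAt (h : IsHomogeneousSteadyEuler α V P)
    (hs : ∀ φ, s φ = Real.sin φ • EuclideanSpace.single 0 (1 : ℝ) +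
      Real.cos φ • EuclideanSpace.single 2 (1 : ℝ))
    (he : ∀ φ, e φ = Real.cos φ • EuclideanSpace.single 0 (1 : ℝ) -
      Real.sin φ • EuclideanSpace.single 2 (1 : ℝ))
    (ha : ∀ ψ, a ψ = ⟪V (s ψ), e ψ⟫) (hb : ∀ ψ, b ψ = V (s ψ) 1) (hf : ∀ ψ, f ψ = ⟪V (s ψ), s ψ⟫)
    (hp : ∀ ψ, p ψ = P (s ψ)) (hH : ∀ ψ, H ψ = ‖V (s ψ)‖ ^ 2 + 2 * P (s ψ)) (φ : ℝ) :
    HasDerivAt a (⟪fderiv ℝ V (s φ) (e φ), e φ⟫ - f φ) φ ∧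
      HasDerivAt b (fderiv ℝ V (s φ) (e φ) 1) φ ∧
      HasDerivAt f (⟪fderiv ℝ V (s φ) (e φ), s φ⟫ + a φ) φ ∧
      HasDerivAt p (fderiv ℝ P (s φ) (e φ)) φ ∧
      HasDerivAt H (fderiv ℝ (fun y => ‖V y‖ ^ 2 + 2 * P y) (s φ) (e φ)) φ := by
  have hx := merid_ne_zero hs φ
  have hVs : HasDerivAt (fun ψ => V (s ψ)) (fderiv ℝ V (s φ) (e φ)) φ :=
    (h.differentiableAt_velocity hx).hasFDerivAt.comp_hasDerivAt φ (hasDerivAt_merid hs he φ)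
  refine ⟨?_, ?_, ?_, ?_, ?_⟩
  · rw [hf]; exact hasDerivAt_a h hs he ha φ
  · rw [show b = fun ψ => ⟪V (s ψ), EuclideanSpace.single 1 (1 : ℝ)⟫ from
      funext fun ψ => by rw [hb, inner_single_one]]
    refine (hVs.inner ℝ (hasDerivAt_const φ (EuclideanSpace.single 1 (1 : ℝ)))).congr_deriv ?_
    rw [inner_zero_right, zero_add, inner_single_one]
  · rw [show f = fun ψ => ⟪V (s ψ), s ψ⟫ from funext hf, ha]
    refine (hVs.inner ℝ (hasDerivAt_merid hs he φ)).congr_deriv ?_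
    ring
  · rw [show p = fun ψ => P (s ψ) from funext hp]
    exact hasDerivAt_p h hs he φ
  · exact hasDerivAt_H h hs he hH φ

/-- **Shvydkoy's axisymmetric system on the meridian, incompressibility equation**
(§5, first equation of the system: `(2-α) f + a' + a cot φ = 0`), in the form multiplied by
`sin φ`, valid at every polar angle (poles included): `a' sin φ + a cos φ + (2-α) f sin φ = 0`.
[cite: Shvydkoy2018, §5 (axisymmetric system, eq. 1)] -/
theorem meridian_div (h : IsHomogeneousSteadyEuler α V P) (hax : IsAxisymmetric V)
    (hs : ∀ φ, s φ = Real.sin φ • EuclideanSpace.single 0 (1 : ℝ) +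
      Real.cos φ • EuclideanSpace.single 2 (1 : ℝ))
    (he : ∀ φ, e φ = Real.cos φ • EuclideanSpace.single 0 (1 : ℝ) -
      Real.sin φ • EuclideanSpace.single 2 (1 : ℝ))
    (ha : ∀ ψ, a ψ = ⟪V (s ψ), e ψ⟫) (hf : ∀ ψ, f ψ = ⟪V (s ψ), s ψ⟫) (φ : ℝ) :
    deriv a φ * Real.sin φ + a φ * Real.cos φ + (2 - α) * f φ * Real.sin φ = 0 := by
  rw [(hasDerivAt_a h hs he ha φ).deriv, ha, hf]
  linear_combination div_merid h hax hs he φ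

/-- **Shvydkoy's axisymmetric system on the meridian, the three momentum equations** (§5, second
to fourth equations: `a f' = a² + b² + αf² + 2αp`, `(1-α) f a + a a' - b² cot φ = -p'`,
`(1-α) f b + a b' + a b cot φ = 0`), each multiplied by `sin φ` and valid at every polar angle:
`(a f' - (a² + b² + α f² + 2α p)) sin φ = 0`, `(a a' + (1-α) f a + p') sin φ - b² cos φ = 0`,
`(a b' + (1-α) f b) sin φ + a b cos φ = 0`. [cite: Shvydkoy2018, §5 (axisymmetric system, eqs. 2–4)] -/
theorem meridian_momentum (h : IsHomogeneousSteadyEuler α V P) (hax : IsAxisymmetric V)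
    (haxP : IsAxisymmetricScalar P)
    (hs : ∀ φ, s φ = Real.sin φ • EuclideanSpace.single 0 (1 : ℝ) +
      Real.cos φ • EuclideanSpace.single 2 (1 : ℝ))
    (he : ∀ φ, e φ = Real.cos φ • EuclideanSpace.single 0 (1 : ℝ) -
      Real.sin φ • EuclideanSpace.single 2 (1 : ℝ))
    (ha : ∀ ψ, a ψ = ⟪V (s ψ), e ψ⟫) (hb : ∀ ψ, b ψ = V (s ψ) 1) (hf : ∀ ψ, f ψ = ⟪V (s ψ), s ψ⟫)
    (hp : ∀ ψ, p ψ = P (s ψ)) (φ : ℝ) :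
    (a φ * deriv f φ - (a φ ^ 2 + b φ ^ 2 + α * f φ ^ 2 + 2 * α * p φ)) * Real.sin φ = 0 ∧
      (a φ * deriv a φ + (1 - α) * f φ * a φ + deriv p φ) * Real.sin φ
        - b φ ^ 2 * Real.cos φ = 0 ∧
      (a φ * deriv b φ + (1 - α) * f φ * b φ) * Real.sin φ + a φ * b φ * Real.cos φ = 0 := by
  have hx := merid_ne_zero hs φ
  have hHd : ∀ ψ, (fun ψ => ‖V (s ψ)‖ ^ 2 + 2 * P (s ψ)) ψ = ‖V (s ψ)‖ ^ 2 + 2 * P (s ψ) :=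
    fun ψ => rfl
  obtain ⟨hda, hdb, hdf, hdp, -⟩ := meridian_hasDerivAt h hs he ha hb hf hp hHd φ
  rw [hda.deriv, hdb.deriv, hdf.deriv, hdp.deriv, ha, hb, hf, hp]
  set A := fderiv ℝ V (s φ) with hA
  obtain ⟨hJe, hJs⟩ := inner_rotGen_frame hs he (V (s φ)) φ
  have hAs : A (s φ) = (-α) • V (s φ) := h.fderiv_velocity_apply_self hx
  have hA1 : Real.sin φ • A (EuclideanSpace.single 1 (1 : ℝ)) = rotGen (V (s φ)) :=
    sin_smul_fderiv_velocity_single_one h hax hs φ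
  have hPs : fderiv ℝ P (s φ) (s φ) = -(2 * α) * P (s φ) := h.fderiv_pressure_apply_self hx
  have hP1 : Real.sin φ * fderiv ℝ P (s φ) (EuclideanSpace.single 1 (1 : ℝ)) = 0 :=
    sin_mul_fderiv_scalar_single_one haxP hs (h.differentiableAt_pressure hx)
  have hV0 := velocity_apply_zero (V := V) hs he φ
  -- `sin • A V = a sin • A e + b • J V + f sin • (-α V)`
  have hV := frame_decomp hs he (V (s φ)) φ
  have hAV : Real.sin φ • A (V (s φ)) = (Real.sin φ * ⟪V (s φ), e φ⟫) • A (e φ) +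
      V (s φ) 1 • rotGen (V (s φ)) + (Real.sin φ * ⟪V (s φ), s φ⟫) • ((-α) • V (s φ)) := by
    conv_lhs => rw [hV]
    rw [map_add, map_add, map_smul, map_smul, map_smul, smul_add, smul_add,
      smul_comm (Real.sin φ) (V (s φ) 1), hA1, hAs, smul_smul, smul_smul]
  -- the momentum equation paired with `s`, `e`, `E₁`
  have m_s : Real.sin φ * ⟪A (V (s φ)), s φ⟫ = Real.sin φ * (2 * α * P (s φ)) := by
    rw [inner_fderiv_velocity_velocity h hx (s φ), hPs]; ring
  have m_e : Real.sin φ * ⟪A (V (s φ)), e φ⟫ = -(Real.sin φ * fderiv ℝ P (s φ) (e φ)) := by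
    rw [inner_fderiv_velocity_velocity h hx (e φ), mul_neg]
  have m_1 : Real.sin φ * ⟪A (V (s φ)), EuclideanSpace.single 1 (1 : ℝ)⟫ = 0 := by
    rw [inner_fderiv_velocity_velocity h hx, mul_neg, hP1, neg_zero]
  rw [← real_inner_smul_left, hAV] at m_s m_e m_1
  simp only [inner_add_left, inner_smul_left, conj_trivial] at m_s m_e m_1
  rw [hJs] at m_s
  rw [hJe] at m_e
  simp only [inner_single_one, rotGen_apply_one] at m_1
  rw [hV0] at m_1
  refine ⟨?_, ?_, ?_⟩
  · linear_combination m_s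
  · linear_combination m_e
  · linear_combination m_1

/-- **Shvydkoy's Bernoulli transport on the meridian** (§5: `a H' = 2α f H`, from (8)
`v∇H = 2αfH`), multiplied by `sin φ` and valid at every polar angle: `(a H' - 2α f H) sin φ = 0`.
[cite: Shvydkoy2018, §5 (a H' = 2α f H)] -/
theorem meridian_bernoulli_transport (h : IsHomogeneousSteadyEuler α V P) (hax : IsAxisymmetric V)
    (haxP : IsAxisymmetricScalar P)
    (hs : ∀ φ, s φ = Real.sin φ • EuclideanSpace.single 0 (1 : ℝ) +
      Real.cos φ • EuclideanSpace.single 2 (1 : ℝ))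
    (he : ∀ φ, e φ = Real.cos φ • EuclideanSpace.single 0 (1 : ℝ) -
      Real.sin φ • EuclideanSpace.single 2 (1 : ℝ))
    (ha : ∀ ψ, a ψ = ⟪V (s ψ), e ψ⟫) (hf : ∀ ψ, f ψ = ⟪V (s ψ), s ψ⟫)
    (hH : ∀ ψ, H ψ = ‖V (s ψ)‖ ^ 2 + 2 * P (s ψ)) (φ : ℝ) :
    (a φ * deriv H φ - 2 * α * f φ * H φ) * Real.sin φ = 0 := by
  rcases eq_or_ne (Real.sin φ) 0 with hs0 | hs0
  · rw [hs0, mul_zero]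
  · rw [(hasDerivAt_H h hs he hH φ).deriv, ha, hf, hH,
      bernoulli_transport_merid h hax haxP hs he hs0, sub_self, zero_mul]

/-- Horizontal components of an axisymmetric field vanish on the axis: if `x₀ = x₁ = 0` then
`(V x)₀ = (V x)₁ = 0` (rotate by `π`). [folklore] -/
private theorem horizontal_eq_zero_on_axis (hax : IsAxisymmetric V) {x : EuclideanSpace ℝ (Fin 3)}
    (hx : x 0 = 0 ∧ x 1 = 0) : V x 0 = 0 ∧ V x 1 = 0 := by
  have hfix : rotZ Real.pi x = x := by
    ext i; fin_cases i
    · show rotZ Real.pi x 0 = x 0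
      rw [rotZ_apply_zero, hx.1, hx.2]; simp
    · show rotZ Real.pi x 1 = x 1
      rw [rotZ_apply_one, hx.1, hx.2]; simp
    · rfl
  have key := hax Real.pi x
  rw [hfix] at key
  have k0 := congrArg (fun w : EuclideanSpace ℝ (Fin 3) => w 0) key
  have k1 := congrArg (fun w : EuclideanSpace ℝ (Fin 3) => w 1) key
  simp only [rotZ_apply_zero, rotZ_apply_one, Real.cos_pi, Real.sin_pi] at k0 k1
  constructor <;> linarith

/-- Evenness at the axis: for an axisymmetric `V` differentiable at an axis point `q`
(`q₀ = q₁ = 0`), `⟪DV(q) E₀, E₂⟫ = 0` (the axial component is even under `t ↦ -t` along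
`t E₀ + q`, by the rotation by `π`). [folklore] -/
private theorem inner_fderiv_single_zero_single_two_on_axis (hax : IsAxisymmetric V)
    {q : EuclideanSpace ℝ (Fin 3)} (hq : q 0 = 0 ∧ q 1 = 0) (hd : DifferentiableAt ℝ V q) :
    ⟪fderiv ℝ V q (EuclideanSpace.single 0 (1 : ℝ)), EuclideanSpace.single 2 (1 : ℝ)⟫ = 0 := by
  -- the axial component along the line `t ↦ t E₀ + q` is even
  set k : ℝ → ℝ := fun t =>
    ⟪V (t • EuclideanSpace.single 0 (1 : ℝ) + q), EuclideanSpace.single 2 (1 : ℝ)⟫ with hk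
  set D : ℝ := ⟪fderiv ℝ V q (EuclideanSpace.single 0 (1 : ℝ)), EuclideanSpace.single 2 (1 : ℝ)⟫
    with hD
  have hline : HasDerivAt (fun t : ℝ => t • EuclideanSpace.single (0 : Fin 3) (1 : ℝ) + q)
      (EuclideanSpace.single (0 : Fin 3) (1 : ℝ)) 0 := by
    simpa using ((hasDerivAt_id (0 : ℝ)).smul_const
      (EuclideanSpace.single (0 : Fin 3) (1 : ℝ))).add_const q
  have hq0 : (0 : ℝ) • EuclideanSpace.single (0 : Fin 3) (1 : ℝ) + q = q := by
    rw [zero_smul, zero_add]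
  have hd0 : DifferentiableAt ℝ V ((0 : ℝ) • EuclideanSpace.single (0 : Fin 3) (1 : ℝ) + q) := by
    rwa [hq0]
  have hcomp := hd0.hasFDerivAt.comp_hasDerivAt (0 : ℝ) hline
  rw [hq0] at hcomp
  have hk' : HasDerivAt k D 0 := by
    refine (hcomp.inner ℝ (hasDerivAt_const (0 : ℝ)
      (EuclideanSpace.single (2 : Fin 3) (1 : ℝ)))).congr_deriv ?_
    rw [inner_zero_right, zero_add]
  have heven : ∀ t, k (-t) = k t := by
    intro t
    have hrot : rotZ Real.pi (t • EuclideanSpace.single 0 (1 : ℝ) + q) =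
        (-t) • EuclideanSpace.single 0 (1 : ℝ) + q := by
      ext i; fin_cases i
      · show rotZ Real.pi _ 0 = _
        rw [rotZ_apply_zero]; simp [hq.1, hq.2]
      · show rotZ Real.pi _ 1 = _
        rw [rotZ_apply_one]; simp [hq.1, hq.2]
      · show rotZ Real.pi _ 2 = _
        rw [rotZ_apply_two]; simp
    have key := hax Real.pi (t • EuclideanSpace.single 0 (1 : ℝ) + q)
    rw [hrot] at key
    have := congrArg (fun w : EuclideanSpace ℝ (Fin 3) => w 2) key
    simp only [rotZ_apply_two] at this
    simp only [hk, EuclideanSpace.inner_single_right, this]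
  -- an even differentiable function has zero derivative at `0`
  have hk'' : HasDerivAt k D (-(0 : ℝ)) := by rw [neg_zero]; exact hk'
  have hneg : HasDerivAt (k ∘ Neg.neg) (-D) 0 :=
    (hk''.comp (0 : ℝ) (hasDerivAt_neg (0 : ℝ))).congr_deriv (by ring)
  have heq : k ∘ Neg.neg = k := funext heven
  rw [heq] at hneg
  have := hk'.unique hneg
  linarith

/-- **Pole conditions of the meridian functions** (§5: "In order for a solution to remain smooth
at the pole we necessarily have `a(0) = a(π) = b(0) = b(π) = 0`"), together with the evenness
relations `f'(0) = f'(π) = 0` (the axial velocity is even across the axis); here for the tree's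
`C¹` class, from axisymmetry alone (rotation by `π` fixes the axis). [cite: Shvydkoy2018, §5 (pole conditions)] -/
theorem meridian_poles (h : IsHomogeneousSteadyEuler α V P) (hax : IsAxisymmetric V)
    (hs : ∀ φ, s φ = Real.sin φ • EuclideanSpace.single 0 (1 : ℝ) +
      Real.cos φ • EuclideanSpace.single 2 (1 : ℝ))
    (he : ∀ φ, e φ = Real.cos φ • EuclideanSpace.single 0 (1 : ℝ) -
      Real.sin φ • EuclideanSpace.single 2 (1 : ℝ))
    (ha : ∀ ψ, a ψ = ⟪V (s ψ), e ψ⟫) (hb : ∀ ψ, b ψ = V (s ψ) 1) (hf : ∀ ψ, f ψ = ⟪V (s ψ), s ψ⟫) :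
    a 0 = 0 ∧ a Real.pi = 0 ∧ b 0 = 0 ∧ b Real.pi = 0 ∧ deriv f 0 = 0 ∧ deriv f Real.pi = 0 := by
  have hs0 : s 0 = EuclideanSpace.single 2 (1 : ℝ) := by simp [hs]
  have hsπ : s Real.pi = -EuclideanSpace.single 2 (1 : ℝ) := by simp [hs]
  have he0 : e 0 = EuclideanSpace.single 0 (1 : ℝ) := by simp [he]
  have heπ : e Real.pi = -EuclideanSpace.single 0 (1 : ℝ) := by simp [he]
  have hax2 : (EuclideanSpace.single (2 : Fin 3) (1 : ℝ)) 0 = 0 ∧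
      (EuclideanSpace.single (2 : Fin 3) (1 : ℝ)) 1 = 0 := by simp
  have hax2' : (-EuclideanSpace.single (2 : Fin 3) (1 : ℝ)) 0 = 0 ∧
      (-EuclideanSpace.single (2 : Fin 3) (1 : ℝ)) 1 = 0 := by simp
  have hne2 : (EuclideanSpace.single (2 : Fin 3) (1 : ℝ)) ≠ 0 := by
    rw [← hs0]; exact merid_ne_zero hs 0
  have hne2' : (-EuclideanSpace.single (2 : Fin 3) (1 : ℝ)) ≠ 0 := neg_ne_zero.mpr hne2
  obtain ⟨v00, v01⟩ := horizontal_eq_zero_on_axis hax hax2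
  obtain ⟨v10, v11⟩ := horizontal_eq_zero_on_axis hax hax2'
  have hp := fun ψ => (rfl : (fun ψ => P (s ψ)) ψ = P (s ψ))
  have hHd : ∀ ψ, (fun ψ => ‖V (s ψ)‖ ^ 2 + 2 * P (s ψ)) ψ = ‖V (s ψ)‖ ^ 2 + 2 * P (s ψ) :=
    fun ψ => rfl
  have ha0 : a 0 = 0 := by
    rw [ha, hs0, he0, EuclideanSpace.inner_single_right]; simpa using v00
  have haπ : a Real.pi = 0 := by
    rw [ha, hsπ, heπ, inner_neg_right, EuclideanSpace.inner_single_right]; simpa using v10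
  refine ⟨ha0, haπ, ?_, ?_, ?_, ?_⟩
  · rw [hb, hs0]; exact v01
  · rw [hb, hsπ]; exact v11
  · obtain ⟨-, -, hdf, -, -⟩ := meridian_hasDerivAt h hs he ha hb hf hp hHd 0
    rw [hdf.deriv, ha0, add_zero, hs0, he0]
    exact inner_fderiv_single_zero_single_two_on_axis hax hax2 (h.differentiableAt_velocity hne2)
  · obtain ⟨-, -, hdf, -, -⟩ := meridian_hasDerivAt h hs he ha hb hf hp hHd Real.pi
    rw [hdf.deriv, haπ, add_zero, hsπ, heπ, map_neg, inner_neg_neg]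
    exact inner_fderiv_single_zero_single_two_on_axis hax hax2' (h.differentiableAt_velocity hne2')

/-- The meridian point and frame are `C^∞` functions of the angle (any finite order `n`). [folklore] -/
private theorem contDiff_merid_frame_of (n : WithTop ℕ∞)
    (hs : ∀ φ, s φ = Real.sin φ • EuclideanSpace.single 0 (1 : ℝ) +
      Real.cos φ • EuclideanSpace.single 2 (1 : ℝ))
    (he : ∀ φ, e φ = Real.cos φ • EuclideanSpace.single 0 (1 : ℝ) -
      Real.sin φ • EuclideanSpace.single 2 (1 : ℝ)) : ContDiff ℝ n s ∧ ContDiff ℝ n e := by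
  constructor
  · rw [show s = fun φ => Real.sin φ • EuclideanSpace.single 0 (1 : ℝ) +
        Real.cos φ • EuclideanSpace.single 2 (1 : ℝ) from funext hs]
    exact (Real.contDiff_sin.smul contDiff_const).add (Real.contDiff_cos.smul contDiff_const)
  · rw [show e = fun φ => Real.cos φ • EuclideanSpace.single 0 (1 : ℝ) -
        Real.sin φ • EuclideanSpace.single 2 (1 : ℝ) from funext he]
    exact (Real.contDiff_cos.smul contDiff_const).sub (Real.contDiff_sin.smul contDiff_const)

/-- **Regularity of the meridian functions**: if `V` and `P` are `Cⁿ` off the origin (e.g. the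
`C²` hypotheses of `shvydkoy2018_prop51_noAxisymmetric`, "`a, b, f, p ∈ C²(S²)`"), then the
meridian functions `a, b, f, p, H` are `Cⁿ` functions of the polar angle on all of `ℝ`.
[cite: Shvydkoy2018, §5 (Prop. 5.1, the `C²` class)] -/
theorem meridian_contDiff {n : WithTop ℕ∞} (hV : ContDiffOn ℝ n V {x | x ≠ 0})
    (hP : ContDiffOn ℝ n P {x | x ≠ 0})
    (hs : ∀ φ, s φ = Real.sin φ • EuclideanSpace.single 0 (1 : ℝ) +
      Real.cos φ • EuclideanSpace.single 2 (1 : ℝ))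
    (he : ∀ φ, e φ = Real.cos φ • EuclideanSpace.single 0 (1 : ℝ) -
      Real.sin φ • EuclideanSpace.single 2 (1 : ℝ))
    (ha : ∀ ψ, a ψ = ⟪V (s ψ), e ψ⟫) (hb : ∀ ψ, b ψ = V (s ψ) 1) (hf : ∀ ψ, f ψ = ⟪V (s ψ), s ψ⟫)
    (hp : ∀ ψ, p ψ = P (s ψ)) (hH : ∀ ψ, H ψ = ‖V (s ψ)‖ ^ 2 + 2 * P (s ψ)) :
    ContDiff ℝ n (fun ψ => V (s ψ)) ∧ ContDiff ℝ n a ∧ ContDiff ℝ n b ∧ ContDiff ℝ n f ∧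
      ContDiff ℝ n p ∧ ContDiff ℝ n H := by
  obtain ⟨hsn, hen⟩ := contDiff_merid_frame_of n hs he
  have hVs : ContDiff ℝ n (fun ψ => V (s ψ)) :=
    hV.comp_contDiff hsn fun ψ => merid_ne_zero hs ψ
  have hPs : ContDiff ℝ n (fun ψ => P (s ψ)) :=
    hP.comp_contDiff hsn fun ψ => merid_ne_zero hs ψ
  refine ⟨hVs, ?_, ?_, ?_, ?_, ?_⟩
  · rw [show a = fun ψ => ⟪V (s ψ), e ψ⟫ from funext ha]; exact hVs.inner ℝ hen
  · rw [show b = fun ψ => ⟪V (s ψ), EuclideanSpace.single 1 (1 : ℝ)⟫ from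
      funext fun ψ => by rw [hb, inner_single_one]]
    exact hVs.inner ℝ contDiff_const
  · rw [show f = fun ψ => ⟪V (s ψ), s ψ⟫ from funext hf]; exact hVs.inner ℝ hsn
  · rw [show p = fun ψ => P (s ψ) from funext hp]; exact hPs
  · rw [show H = fun ψ => ‖V (s ψ)‖ ^ 2 + 2 * P (s ψ) from funext hH]
    exact (hVs.norm_sq ℝ).add (contDiff_const.mul hPs)

/-- **The velocity on the meridian in Shvydkoy's spherical frame**: `V(s φ) = a e_φ + b e_θ + f n`
with `e_φ = e φ`, `e_θ = E₁`, `n = s φ` (Shvydkoy (2) `V = (v + f n)/|x|^α`, `v = a e_φ + b e_θ`,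
§2 display "x = sin φ cos θ, y = sin φ sin θ, z = cos φ, v = a e_φ + b e_θ", on the unit sphere and
the meridian `θ = 0`), and consequently `‖V(s φ)‖² = a² + b² + f²`.
[cite: Shvydkoy2018, (2) p. 2518 and §2 (spherical frame)] -/
theorem meridian_velocity_eq
    (hs : ∀ φ, s φ = Real.sin φ • EuclideanSpace.single 0 (1 : ℝ) +
      Real.cos φ • EuclideanSpace.single 2 (1 : ℝ))
    (he : ∀ φ, e φ = Real.cos φ • EuclideanSpace.single 0 (1 : ℝ) -
      Real.sin φ • EuclideanSpace.single 2 (1 : ℝ))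
    (ha : ∀ ψ, a ψ = ⟪V (s ψ), e ψ⟫) (hb : ∀ ψ, b ψ = V (s ψ) 1) (hf : ∀ ψ, f ψ = ⟪V (s ψ), s ψ⟫)
    (φ : ℝ) :
    V (s φ) = a φ • e φ + b φ • EuclideanSpace.single 1 (1 : ℝ) + f φ • s φ ∧
      ‖V (s φ)‖ ^ 2 = a φ ^ 2 + b φ ^ 2 + f φ ^ 2 := by
  rw [ha, hb, hf]
  exact ⟨frame_decomp hs he (V (s φ)) φ, norm_sq_frame hs he (V (s φ)) φ⟩

/-- **Spherical coordinates** (Shvydkoy §2: `x = sin φ cos θ`, `y = sin φ sin θ`, `z = cos φ`):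
every `y ≠ 0` in `ℝ³` is `‖y‖ · R_θ (s φ)` for some azimuth `θ` and polar angle `φ ∈ [0, π]`,
where `R_θ = rotZ θ` is the rotation about the `x₂`-axis and `s φ = (sin φ, 0, cos φ)` the
meridian point. [cite: Shvydkoy2018, §2 (spherical coordinates)] -/
theorem exists_eq_norm_smul_rotZ_meridian
    (hs : ∀ φ, s φ = Real.sin φ • EuclideanSpace.single 0 (1 : ℝ) +
      Real.cos φ • EuclideanSpace.single 2 (1 : ℝ))
    {y : EuclideanSpace ℝ (Fin 3)} (hy : y ≠ 0) :
    ∃ θ φ : ℝ, φ ∈ Icc 0 Real.pi ∧ y = ‖y‖ • rotZ θ (s φ) :=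
  exists_rotZ_merid hs hy

/-- **From the meridian to space**: for an axisymmetric homogeneous velocity field (Shvydkoy §5:
"we let all ingredients depend only on `φ`"), vanishing on the closed meridian `φ ∈ [0, π]` of the
unit sphere forces vanishing on all of `ℝ³ ∖ {0}` (rotate by `θ`, scale by `‖x‖`).
[cite: Shvydkoy2018, §5 (axisymmetric ansatz) and (2)] -/
theorem eq_zero_of_meridian_velocity_eq_zero (h : IsHomogeneousSteadyEuler α V P)
    (hax : IsAxisymmetric V)
    (hs : ∀ φ, s φ = Real.sin φ • EuclideanSpace.single 0 (1 : ℝ) +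
      Real.cos φ • EuclideanSpace.single 2 (1 : ℝ))
    (hV0 : ∀ φ ∈ Icc 0 Real.pi, V (s φ) = 0) ⦃x : EuclideanSpace ℝ (Fin 3)⦄ (hx : x ≠ 0) :
    V x = 0 := by
  obtain ⟨θ, φ, hφ, hxeq⟩ := exists_rotZ_merid hs hx
  have hrot0 : rotZ θ (s φ) ≠ 0 := by
    intro h0'
    have := norm_rotZ θ (s φ)
    rw [h0', norm_zero] at this
    have h1' := norm_sq_merid hs φ
    rw [← this] at h1'
    norm_num at h1'
  have hVrot : V (rotZ θ (s φ)) = 0 := by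
    rw [hax θ (s φ), hV0 φ hφ]
    ext i; fin_cases i <;> simp
  rw [hxeq, h.velocity_smul (norm_pos_iff.mpr hx) hrot0, hVrot, smul_zero]

end MeridianInterface

end IsHomogeneousSteadyEuler

/-- **Shvydkoy 2018, Prop. 5.1, window half, in the shape of the named fact
`shvydkoy2018_prop51_noAxisymmetric`** (`HomogeneousEulerAxisymmetric.lean`; that fact is the
printed range `0 < α < 2`): for `1 < α < 2` there is no non-trivial `C²` (indeed no `C¹`)
axisymmetric homogeneous stationary Euler flow of degree `-α` on `ℝ³ ∖ {0}`.  The `C²`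
hypotheses of the fact are carried and not used. [cite: Shvydkoy2018, Prop. 5.1] -/
theorem shvydkoy2018_prop51_noAxisymmetric_of_one_lt :
    ∀ ⦃α : ℝ⦄, 1 < α → α < 2 →
    ∀ ⦃V : EuclideanSpace ℝ (Fin 3) → EuclideanSpace ℝ (Fin 3)⦄ ⦃P : EuclideanSpace ℝ (Fin 3) → ℝ⦄,
      IsHomogeneousSteadyEuler α V P →
      ContDiffOn ℝ 2 V {x | x ≠ 0} → ContDiffOn ℝ 2 P {x | x ≠ 0} →
      IsAxisymmetric V → IsAxisymmetricScalar P →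
        ∀ x, x ≠ 0 → V x = 0 :=
  fun _ h1 h2 _ _ hVP _ _ hax haxP _ hx => hVP.eq_zero_of_isAxisymmetric hax haxP h1 h2 hx

/-- **Corollary (velocity and pressure).** In the window `1 < α < 2` an axisymmetric `C¹`
homogeneous stationary Euler pair on `ℝ³ ∖ {0}` has `V ≡ 0` and `P ≡ 0` off the origin
(the pressure by Euler's relation, `IsHomogeneousSteadyEuler.pressure_eq_zero_of_velocity_eq_zero`).
[cite: Shvydkoy2018, Prop. 5.1] -/
theorem shvydkoy2018_prop51_noAxisymmetric_of_one_lt.eq_zero {α : ℝ} (h1 : 1 < α) (h2 : α < 2)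
    {V : EuclideanSpace ℝ (Fin 3) → EuclideanSpace ℝ (Fin 3)} {P : EuclideanSpace ℝ (Fin 3) → ℝ}
    (hVP : IsHomogeneousSteadyEuler α V P) (hax : IsAxisymmetric V)
    (haxP : IsAxisymmetricScalar P) ⦃x : EuclideanSpace ℝ (Fin 3)⦄ (hx : x ≠ 0) :
    V x = 0 ∧ P x = 0 :=
  ⟨hVP.eq_zero_of_isAxisymmetric hax haxP h1 h2 hx,
    hVP.pressure_eq_zero_of_velocity_eq_zero (by linarith)
      (fun _ hy => hVP.eq_zero_of_isAxisymmetric hax haxP h1 h2 hy) hx⟩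

end Literature.Analysis.FluidPDE
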